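import Literature.Analysis.FluidPDE.LerayHopfH1Test
import Literature.Analysis.FunctionSpaces.TimeDoubling
import HarnessLib

/-!
# Estimates for Serrin's weak–strong uniqueness argument

Analysis/FluidPDE support file (serves the discharge of the Serrin–Prodi weak–strong uniqueness
theorem `Literature.Analysis.FluidPDE.weak_strong_uniqueness`, sub-fact `Literature.Analysis.FluidPDE.serrin_difference_energy_ineq`;
Serrin 1963, §4; Robinson–Rodrigo–Sadowski 2016, Lemma 8.18 and proof of Thm. 8.19). It collects
the measure-theoretic and Hölder-type estimates entering the passage to the limit in the
time-mollified, cross-tested weak formulations of two Leray–Hopf solutions `u` (Serrin class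
`L^q(0,T;L^r)`, `2/q + 3/r ≤ 1`, `3 < r ≤ ∞`) and `v`:

* exponents: the Hölder triples `(3,6,2)`, `(p, r, 2)` with `p = (2⁻¹ - r⁻¹)⁻¹ = 2r/(r-2)`
  (`holderTriple_conj_two`, `conj_exponent_props`), the Serrin numerics `θ = 3/r ∈ [0,1)`,
  `ofReal (2/(1-θ)) ≤ q` (`serrin_exponent_props`), the conjugate time exponents
  `(2/(1+θ), 2/(1-θ))` (`holderConjugate_serrin`);
* truncation of a field at height `M` (`indicator_norm_lt_add_indicator_le`, measurability) and
  the vanishing of `L^p` tails (`tendsto_eLpNorm_indicator_le_norm`), in time-integrated form for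
  the Serrin-class solution (`tendsto_lintegral_tail_rpow`: `∫₀ᵀ ‖ũ^{≥M}(s)‖_r^{2/(1-θ)} ds → 0`);
* the good times of a Leray–Hopf solution with a jointly measurable weak-gradient witness
  (`IsLerayHopfOn.ae_good`), joint measurability and integrability on the time square `(0,T)²`
  of the trilinear flux `(σ,s) ↦ ∫⟪G(σ)ũ(s), ũ(s)⟫` and of the gradient pairing
  (`integrable_sq_tri`, `integrable_sq_grad`), and the space–time memberships
  `ṽ ∈ L²`, `G ∈ L²`, `G·ṽ ∈ L¹`, `⟪ũ,eᵢ⟫ũ^{<M} ∈ L²` on `(0,T) × E`;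
* the Sobolev–interpolation control of the conjugate slice norm `‖u(s)‖_p ≤ ‖u‖₂^{1-θ}(K_S‖∇u‖₂)^θ`
  (`eLpNorm_conj_le_of_hasWeakGradient`, RRS proof of Lemma 8.18), the two truncation
  remainders bounded uniformly in the mollification parameter by the weighted Hölder inequality
  of `TimeMollification` (`remainderA_le`, `remainderB_le`, and their diagonal versions), the
  vanishing `∫₀ᵀ(‖ũ‖_p m_M)² → 0` (`tendsto_lintegral_conj_mul_tail_sq`) and the finiteness of the
  B-side weight `∫₀ᵀ(‖∇v‖₂‖ṽ‖_p)^{2/(1+θ)} < ∞` (`lintegral_weightB_lt_top`).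

All statements are for a real inner product space `E` of dimension `3` (the Sobolev embedding
`H¹ ⊂ L⁶` enters through the accepted `Fluid.eLpNorm_le_of_hasWeakGradient`).

## Mathlib search

Hölder (`ENNReal.lintegral_mul_le_Lp_mul_Lq`, `ENNReal.lintegral_mul_norm_pow_le`), tails of
`L^p` functions (`MemLp.eLpNorm_indicator_norm_ge_le`), dominated convergence for `∫⁻`; no
Navier–Stokes content in Mathlib. Everything fluid-specific is from the tree (see imports).

## References

* J. Serrin, *The initial value problem for the Navier–Stokes equations*, in: Nonlinear Problems
  (Madison 1962), Univ. Wisconsin Press 1963, §4 (`Serrin1963`).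
* J. C. Robinson, J. L. Rodrigo, W. Sadowski, *The Three-Dimensional Navier–Stokes Equations*,
  CUP 2016, Thm. 1.5, Lemma 8.18, (8.10), Thm. 8.19 (`RobinsonRodrigoSadowski2016`).
-/

noncomputable section

open MeasureTheory TopologicalSpace Set Function Filter Topology ContinuousLinearMap Module
open scoped ENNReal NNReal Convolution InnerProductSpace RealInnerProductSpace

namespace Literature.Analysis.FluidPDE

variable {E : Type*} [NormedAddCommGroup E] [InnerProductSpace ℝ E] [FiniteDimensional ℝ E]
  [MeasurableSpace E] [BorelSpace E]

/-! ### Exponents -/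

section Exponents

omit [FiniteDimensional ℝ E] [MeasurableSpace E] [BorelSpace E] in
/-- `3⁻¹ + 6⁻¹ = 2⁻¹`: the Hölder triple `(3, 6, 2)`. [folklore] -/
theorem holderTriple_three_six_two : ENNReal.HolderTriple 3 6 2 := by
  refine ⟨?_⟩
  have h3 : (3 : ℝ≥0∞)⁻¹ = 2 * 6⁻¹ := by
    rw [show (6 : ℝ≥0∞) = 2 * 3 by norm_num,
      ENNReal.mul_inv (Or.inl two_ne_zero) (Or.inl ENNReal.ofNat_ne_top), ← mul_assoc,
      ENNReal.mul_inv_cancel two_ne_zero ENNReal.ofNat_ne_top, one_mul]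
  have h6 : (6 : ℝ≥0∞)⁻¹ = 3⁻¹ * 2⁻¹ := by
    rw [show (6 : ℝ≥0∞) = 3 * 2 by norm_num,
      ENNReal.mul_inv (Or.inl (by norm_num)) (Or.inl ENNReal.ofNat_ne_top)]
  calc (3 : ℝ≥0∞)⁻¹ + 6⁻¹ = 2 * 6⁻¹ + 6⁻¹ := by rw [h3]
    _ = (2 + 1) * 6⁻¹ := (add_one_mul _ _).symm
    _ = 3 * (3⁻¹ * 2⁻¹) := by rw [h6]; norm_num
    _ = 2⁻¹ := by
        rw [← mul_assoc, ENNReal.mul_inv_cancel (by norm_num) ENNReal.ofNat_ne_top, one_mul]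

/-- The conjugate space exponent of the Serrin class: for `2 ≤ r` (in fact `3 < r ≤ ∞`) the exponent
`p = (2⁻¹ - r⁻¹)⁻¹ = 2r/(r-2) ∈ [2, 6)` with `1/p + 1/r = 1/2`. [folklore] -/
theorem holderTriple_conj_two {r : ℝ≥0∞} (hr : 2 ≤ r) :
    ENNReal.HolderTriple ((2⁻¹ - r⁻¹)⁻¹) r 2 := by
  refine ⟨?_⟩
  rw [inv_inv]
  exact tsub_add_cancel_of_le (ENNReal.inv_le_inv.2 hr)

omit [FiniteDimensional ℝ E] [MeasurableSpace E] [BorelSpace E] in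
/-- Numerics of the conjugate space exponent `p = (2⁻¹ - r⁻¹)⁻¹` for `3 < r`:
`2 ≤ p ≤ 6`, and `3/p = 3/2 - θ·… `; precisely `p.toReal⁻¹ = 2⁻¹ - θ/3` with `θ = (3/r).toReal`,
so that `3/p - 1/2 = 1 - θ` and `3/2 - 3/p = θ`. [folklore] -/
theorem conj_exponent_props {r : ℝ≥0∞} (hr : 3 < r) :
    2 ≤ (2⁻¹ - r⁻¹ : ℝ≥0∞)⁻¹ ∧ (2⁻¹ - r⁻¹ : ℝ≥0∞)⁻¹ ≤ 6 ∧
      (3 / ((2⁻¹ - r⁻¹ : ℝ≥0∞)⁻¹).toReal - 1 / 2 = 1 - ((3 : ℝ≥0∞) / r).toReal) ∧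
      (3 / 2 - 3 / ((2⁻¹ - r⁻¹ : ℝ≥0∞)⁻¹).toReal = ((3 : ℝ≥0∞) / r).toReal) := by
  have hr0 : r ≠ 0 := by rintro rfl; simp at hr
  have h3r : (3 : ℝ≥0∞) ≤ r := hr.le
  have hrinv3 : r⁻¹ ≤ 3⁻¹ := ENNReal.inv_le_inv.2 h3r
  have hrinv2 : r⁻¹ ≤ 2⁻¹ := hrinv3.trans (ENNReal.inv_le_inv.2 (by norm_num))
  -- real version of `r⁻¹`
  set a : ℝ := (r⁻¹).toReal with ha
  have ha0 : 0 ≤ a := ENNReal.toReal_nonneg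
  have ha3 : a ≤ 1 / 3 := by
    rw [ha, show (1 : ℝ) / 3 = ((3 : ℝ≥0∞)⁻¹).toReal by
      rw [ENNReal.toReal_inv, ENNReal.toReal_ofNat, one_div]]
    exact ENNReal.toReal_mono (ENNReal.inv_ne_top.2 (by norm_num)) hrinv3
  have hrtop : r⁻¹ ≠ ⊤ := ENNReal.inv_ne_top.2 hr0
  have hsub : (2⁻¹ - r⁻¹ : ℝ≥0∞) = ENNReal.ofReal (1 / 2 - a) := by
    rw [ENNReal.ofReal_sub _ ha0, ha, ENNReal.ofReal_toReal hrtop]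
    congr 1
    rw [one_div, ENNReal.ofReal_inv_of_pos two_pos, ENNReal.ofReal_ofNat]
  have hpos : 0 < 1 / 2 - a := by linarith
  have hp : ((2⁻¹ - r⁻¹ : ℝ≥0∞)⁻¹).toReal = (1 / 2 - a)⁻¹ := by
    rw [hsub, ENNReal.toReal_inv, ENNReal.toReal_ofReal hpos.le]
  have hθ : ((3 : ℝ≥0∞) / r).toReal = 3 * a := by
    rw [div_eq_mul_inv, ENNReal.toReal_mul, ENNReal.toReal_ofNat, ha]
  refine ⟨?_, ?_, ?_, ?_⟩
  · -- `2 ≤ p`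
    rw [hsub, ENNReal.le_inv_iff_mul_le, ← ENNReal.ofReal_ofNat 2,
      ← ENNReal.ofReal_mul (by norm_num), ← ENNReal.ofReal_one]
    exact ENNReal.ofReal_le_ofReal (by linarith)
  · -- `p ≤ 6`
    rw [hsub, ENNReal.inv_le_iff_le_mul (fun _ => (ENNReal.ofReal_pos.2 hpos).ne')
      (fun h => absurd h ENNReal.ofReal_ne_top),
      ← ENNReal.ofReal_ofNat 6, ← ENNReal.ofReal_mul hpos.le, ← ENNReal.ofReal_one]
    exact ENNReal.ofReal_le_ofReal (by nlinarith)
  · rw [hp, hθ]; field_simp; ring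
  · rw [hp, hθ]; field_simp; ring

end Exponents

/-! ### Truncation of a field at height `M` -/

section Truncation

variable {α : Type*} [MeasurableSpace α] {F : Type*} [NormedAddCommGroup F]

omit [MeasurableSpace α] in
/-- Splitting a field into its parts below and above height `M`. [folklore] -/
theorem indicator_norm_lt_add_indicator_le (f : α → F) (M : ℝ) :
    {x | ‖f x‖ < M}.indicator f + {x | M ≤ ‖f x‖}.indicator f = f := by
  have : {x | M ≤ ‖f x‖} = {x | ‖f x‖ < M}ᶜ := by ext x; simp [not_lt]
  rw [this, Set.indicator_self_add_compl]

omit [MeasurableSpace α] in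
/-- The part below height `M ≥ 0` is bounded by `M`. [folklore] -/
theorem norm_indicator_norm_lt_le (f : α → F) {M : ℝ} (hM : 0 ≤ M) (x : α) :
    ‖{x | ‖f x‖ < M}.indicator f x‖ ≤ M := by
  by_cases hx : x ∈ {x | ‖f x‖ < M}
  · rw [indicator_of_mem hx]; exact le_of_lt hx
  · rw [indicator_of_notMem hx, norm_zero]; exact hM

/-- The parts below/above height `M` of a strongly measurable field are strongly measurable. [folklore] -/
theorem _root_.MeasureTheory.StronglyMeasurable.indicator_norm_lt [TopologicalSpace.PseudoMetrizableSpace F]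
    {f : α → F} (hf : StronglyMeasurable f) (M : ℝ) :
    StronglyMeasurable ({x | ‖f x‖ < M}.indicator f) :=
  hf.indicator (measurableSet_lt hf.norm.measurable measurable_const)

/-- The parts below/above height `M` of a strongly measurable field are strongly measurable. [folklore] -/
theorem _root_.MeasureTheory.StronglyMeasurable.indicator_le_norm [TopologicalSpace.PseudoMetrizableSpace F]
    {f : α → F} (hf : StronglyMeasurable f) (M : ℝ) :
    StronglyMeasurable ({x | M ≤ ‖f x‖}.indicator f) :=
  hf.indicator (measurableSet_le measurable_const hf.norm.measurable)

/-- **The `L^p` tail above height `M` tends to zero** as `M → ∞`, for every `p ∈ [0, ∞]`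
(Mathlib's `MemLp.eLpNorm_indicator_norm_ge_le`, monotonicity in `M`). [folklore] -/
theorem tendsto_eLpNorm_indicator_le_norm {μ : Measure α} {f : α → F} {p : ℝ≥0∞}
    (hf : MemLp f p μ) (hmeas : StronglyMeasurable f) :
    Tendsto (fun M : ℕ => eLpNorm ({x | (M : ℝ) ≤ ‖f x‖}.indicator f) p μ) atTop (𝓝 0) := by
  rw [ENNReal.tendsto_atTop_zero]
  intro ε hε
  -- a real `ε' > 0` with `ofReal ε' ≤ ε`
  obtain ⟨ε', hε'0, hε'⟩ : ∃ ε' : ℝ, 0 < ε' ∧ ENNReal.ofReal ε' ≤ ε := by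
    rcases eq_or_ne ε ⊤ with rfl | htop
    · exact ⟨1, one_pos, le_top⟩
    · exact ⟨ε.toReal, ENNReal.toReal_pos hε.ne' htop, (ENNReal.ofReal_toReal htop).le⟩
  obtain ⟨M₀, hM₀⟩ := hf.eLpNorm_indicator_norm_ge_le hmeas hε'0
  refine ⟨⌈M₀⌉₊, fun n hn => ?_⟩
  have hsub : {x | (n : ℝ) ≤ ‖f x‖} ⊆ {x | M₀ ≤ ‖f x‖₊} := fun x hx => by
    simp only [mem_setOf_eq, coe_nnnorm] at hx ⊢
    exact ((Nat.le_ceil M₀).trans (by exact_mod_cast hn)).trans hx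
  calc eLpNorm ({x | (n : ℝ) ≤ ‖f x‖}.indicator f) p μ
      ≤ eLpNorm ({x | M₀ ≤ ‖f x‖₊}.indicator f) p μ :=
        eLpNorm_mono fun x => norm_indicator_le_of_subset hsub f x
    _ ≤ ENNReal.ofReal ε' := hM₀
    _ ≤ ε := hε'

end Truncation

/-! ### An approximation lemma -/

section Approx

/-- **Uniform approximation and limits.** If `x⁽ᴹ⁾ₙ → y⁽ᴹ⁾` for every `M`, and `x⁽ᴹ⁾`, `y⁽ᴹ⁾`
approximate `x`, `y` uniformly in `n` to any accuracy for suitable `M`, then `xₙ → y`. [folklore] -/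
theorem tendsto_of_unif_approx {x : ℕ → ℝ} {y : ℝ} (xM : ℕ → ℕ → ℝ) (yM : ℕ → ℝ)
    (h1 : ∀ M, Tendsto (xM M) atTop (𝓝 (yM M)))
    (h2 : ∀ ε > 0, ∃ M, (∀ n, |x n - xM M n| ≤ ε) ∧ |y - yM M| ≤ ε) :
    Tendsto x atTop (𝓝 y) := by
  rw [Metric.tendsto_atTop]
  intro ε hε
  obtain ⟨M, hxM, hyM⟩ := h2 (ε / 4) (by positivity)
  obtain ⟨N, hN⟩ := Metric.tendsto_atTop.1 (h1 M) (ε / 4) (by positivity)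
  refine ⟨N, fun n hn => ?_⟩
  have h := hN n hn
  rw [Real.dist_eq] at h ⊢
  calc |x n - y| = |(x n - xM M n) + (xM M n - yM M) + (yM M - y)| := by ring_nf
    _ ≤ |x n - xM M n| + |xM M n - yM M| + |yM M - y| := abs_add_three _ _ _
    _ ≤ ε / 4 + ε / 4 + ε / 4 := by
        have h3 : |yM M - y| ≤ ε / 4 := by rw [abs_sub_comm]; exact hyM
        linarith [hxM n, h.le, h3]
    _ < ε := by linarith

end Approx

/-! ### Slices of Leray–Hopf solutions: the good times -/

section GoodTimes

variable {T ν : ℝ} {u₀ : E → E} {u : ℝ → E → E}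

/-- Symmetry of the real `L²` pairing. [folklore] -/
theorem integral_inner_comm (f g : E → E) : ∫ x, ⟪f x, g x⟫ = ∫ x, ⟪g x, f x⟫ :=
  integral_congr_ae (ae_of_all _ fun _ => real_inner_comm _ _)

/-- **Uniform energy bound** under the energy inequality from `0`: `E(u(t)) ≤ E(u₀)` on `[0,T]`. [folklore] -/
theorem kineticEnergy_le_of_energy_ineq {G : ℝ → E → E →L[ℝ] E} (hν : 0 ≤ ν)
    (hE : ∀ t ∈ Icc 0 T, VectorCalculus.kineticEnergy (u t) +
      ν * (∫⁻ τ in Ioo 0 t, ∫⁻ x, ENNReal.ofReal (frobeniusNormSq (G τ x))).toReal ≤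
        VectorCalculus.kineticEnergy u₀) {t : ℝ} (ht : t ∈ Icc 0 T) :
    VectorCalculus.kineticEnergy (u t) ≤ VectorCalculus.kineticEnergy u₀ :=
  le_trans (le_add_of_nonneg_right (mul_nonneg hν ENNReal.toReal_nonneg)) (hE t ht)

/-- The slices of a jointly measurable version agree with the slices of the field a.e., for
a.e. time. [folklore] -/
theorem ae_slice_eq_of_uncurry_ae_eq {ut : ℝ × E → E}
    (h : uncurry u =ᵐ[(volume.restrict (Ioo 0 T)).prod (volume : Measure E)] ut) :
    ∀ᵐ s ∂(volume.restrict (Ioo 0 T)), u s =ᵐ[volume] fun x => ut (s, x) := by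
  have h2 : ∀ᵐ s ∂(volume.restrict (Ioo 0 T)), ∀ᵐ x ∂(volume : Measure E),
      uncurry u (s, x) = ut (s, x) := Measure.ae_ae_of_ae_prod h
  filter_upwards [h2] with s hs
  filter_upwards [hs] with x hx
  exact hx

/-- **The good times of a Leray–Hopf solution** with a jointly measurable weak-gradient witness
of finite dissipation, in dimension `3`: for a.e. `s ∈ (0,T)`, `s ∈ (0,T)`, `u(s) ∈ L²` is weakly
divergence free with weak gradient `Gu(s)`, `∫|Gu(s)|² < ∞`, `u(s) ∈ L⁴`, and `u(s)` agrees a.e.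
with the slice of any jointly measurable version `ũ`. [folklore] -/
theorem IsLerayHopfOn.ae_good (hE3 : finrank ℝ E = 3) {f : ℝ → E → E}
    (hu : IsLerayHopfOn T ν f u₀ u) {Gu : ℝ → E → E →L[ℝ] E}
    (hGum : StronglyMeasurable (uncurry Gu))
    (hGu : ∀ᵐ t ∂(volume.restrict (Ioo 0 T)), HasWeakGradient (u t) (Gu t))
    (hGu₂ : ∫⁻ t in Ioo 0 T, ∫⁻ x, ENNReal.ofReal (frobeniusNormSq (Gu t x)) < ⊤)
    {ut : ℝ × E → E}
    (hut : uncurry u =ᵐ[(volume.restrict (Ioo 0 T)).prod (volume : Measure E)] ut) :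
    ∀ᵐ s ∂(volume.restrict (Ioo 0 T)), s ∈ Ioo 0 T ∧ MemLp (u s) 2 volume ∧
      IsWeaklyDivFree (u s) ∧ HasWeakGradient (u s) (Gu s) ∧
      ∫⁻ x, ENNReal.ofReal (frobeniusNormSq (Gu s x)) < ⊤ ∧ eLpNorm (u s) 4 volume < ⊤ ∧
      u s =ᵐ[volume] fun x => ut (s, x) := by
  have hDfin : ∀ᵐ s ∂(volume.restrict (Ioo 0 T)),
      ∫⁻ x, ENNReal.ofReal (frobeniusNormSq (Gu s x)) < ⊤ :=
    ae_lt_top (measurable_lintegral_frobeniusNormSq hGum) hGu₂.ne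
  have h4fin : ∀ᵐ s ∂(volume.restrict (Ioo 0 T)), eLpNorm (u s) 4 volume < ⊤ := by
    have h := ae_lt_top' ((FunctionSpaces.aemeasurable_eLpNorm_slice hu.aestronglyMeasurable_uncurry 4).pow_const
      (2 : ℝ)) (hu.lintegral_eLpNorm_four_sq_lt_top hE3 hGum hGu hGu₂).ne
    filter_upwards [h] with s hs
    exact (ENNReal.rpow_lt_top_iff_of_pos zero_lt_two).1 hs
  filter_upwards [ae_restrict_mem measurableSet_Ioo, hu.weak.2.2.1, hGu, hDfin, h4fin,
    ae_slice_eq_of_uncurry_ae_eq hut] with s hsI hdiv hGs hDs h4s hsl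
  exact ⟨hsI, hu.memLp s (Ioo_subset_Icc_self hsI), hdiv, hGs, hDs, h4s, hsl⟩

end GoodTimes

/-! ### Measurability and integrability on the time square -/

section Square

variable {T ν : ℝ} {u₀ : E → E} {u : ℝ → E → E}

/-- Joint measurability of `(σ, s) ↦ ∫ ⟪G(σ) U(s), V(s)⟫` for jointly measurable data. [folklore] -/
theorem stronglyMeasurable_integral_inner_apply
    {G : ℝ → E → E →L[ℝ] E} (hG : StronglyMeasurable (uncurry G)) {U V : ℝ × E → E}
    (hU : StronglyMeasurable U) (hV : StronglyMeasurable V) :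
    StronglyMeasurable fun p : ℝ × ℝ => ∫ x, ⟪G p.1 x (U (p.2, x)), V (p.2, x)⟫ := by
  have h1 : StronglyMeasurable fun q : (ℝ × ℝ) × E => G q.1.1 q.2 (U (q.1.2, q.2)) := by
    have hG' : StronglyMeasurable fun q : (ℝ × ℝ) × E => uncurry G (q.1.1, q.2) :=
      hG.comp_measurable (measurable_fst.fst.prodMk measurable_snd)
    have hU' : StronglyMeasurable fun q : (ℝ × ℝ) × E => U (q.1.2, q.2) :=
      hU.comp_measurable (measurable_fst.snd.prodMk measurable_snd)
    exact isBoundedBilinearMap_apply.continuous.comp_stronglyMeasurable (hG'.prodMk hU')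
  have h2 : StronglyMeasurable fun q : (ℝ × ℝ) × E => V (q.1.2, q.2) :=
    hV.comp_measurable (measurable_fst.snd.prodMk measurable_snd)
  exact (h1.inner (𝕜 := ℝ) h2).integral_prod_right'

/-- Joint measurability of `(σ, s) ↦ ∫ ⟪U(s), G(σ) V(σ)⟫` for jointly measurable data. [folklore] -/
theorem stronglyMeasurable_integral_inner_apply'
    {G : ℝ → E → E →L[ℝ] E} (hG : StronglyMeasurable (uncurry G)) {U V : ℝ × E → E}
    (hU : StronglyMeasurable U) (hV : StronglyMeasurable V) :
    StronglyMeasurable fun p : ℝ × ℝ => ∫ x, ⟪U (p.2, x), G p.1 x (V (p.1, x))⟫ := by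
  have h1 : StronglyMeasurable fun q : (ℝ × ℝ) × E => G q.1.1 q.2 (V (q.1.1, q.2)) := by
    have hG' : StronglyMeasurable fun q : (ℝ × ℝ) × E => uncurry G (q.1.1, q.2) :=
      hG.comp_measurable (measurable_fst.fst.prodMk measurable_snd)
    have hV' : StronglyMeasurable fun q : (ℝ × ℝ) × E => V (q.1.1, q.2) :=
      hV.comp_measurable (measurable_fst.fst.prodMk measurable_snd)
    exact isBoundedBilinearMap_apply.continuous.comp_stronglyMeasurable (hG'.prodMk hV')
  have h2 : StronglyMeasurable fun q : (ℝ × ℝ) × E => U (q.1.2, q.2) :=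
    hU.comp_measurable (measurable_fst.snd.prodMk measurable_snd)
  exact (h2.inner (𝕜 := ℝ) h1).integral_prod_right'

/-- Joint measurability of the gradient pairing `(σ, s) ↦ ∫ ⟪G₁(s) e, G₂(σ) e⟫`. [folklore] -/
theorem stronglyMeasurable_integral_inner_grad
    {G₁ G₂ : ℝ → E → E →L[ℝ] E} (hG₁ : StronglyMeasurable (uncurry G₁))
    (hG₂ : StronglyMeasurable (uncurry G₂)) (e : E) :
    StronglyMeasurable fun p : ℝ × ℝ => ∫ x, ⟪G₁ p.2 x e, G₂ p.1 x e⟫ := by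
  have h1 : StronglyMeasurable fun q : (ℝ × ℝ) × E => G₁ q.1.2 q.2 e :=
    (ContinuousLinearMap.apply ℝ E e).continuous.comp_stronglyMeasurable
      (hG₁.comp_measurable (measurable_fst.snd.prodMk measurable_snd))
  have h2 : StronglyMeasurable fun q : (ℝ × ℝ) × E => G₂ q.1.1 q.2 e :=
    (ContinuousLinearMap.apply ℝ E e).continuous.comp_stronglyMeasurable
      (hG₂.comp_measurable (measurable_fst.fst.prodMk measurable_snd))
  exact (h1.inner (𝕜 := ℝ) h2).integral_prod_right'

/-- The square root of the dissipation density of a finite-dissipation gradient field is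
integrable in time on `(0,T)` (real form). [folklore] -/
theorem integrable_toReal_sqrt_dissipation {G : ℝ → E → E →L[ℝ] E}
    (hGm : StronglyMeasurable (uncurry G))
    (hG₂ : ∫⁻ t in Ioo 0 T, ∫⁻ x, ENNReal.ofReal (frobeniusNormSq (G t x)) < ⊤) :
    Integrable (fun σ => ((∫⁻ x, ENNReal.ofReal (frobeniusNormSq (G σ x))) ^ (1 / 2 : ℝ)).toReal)
      (volume.restrict (Ioo 0 T)) := by
  have hDm := measurable_lintegral_frobeniusNormSq hGm
  refine integrable_toReal_of_lintegral_ne_top (hDm.pow_const _).aemeasurable (ne_of_lt ?_)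
  calc ∫⁻ σ in Ioo 0 T, (∫⁻ x, ENNReal.ofReal (frobeniusNormSq (G σ x))) ^ (1 / 2 : ℝ)
      ≤ ∫⁻ σ in Ioo 0 T, (1 + ∫⁻ x, ENNReal.ofReal (frobeniusNormSq (G σ x))) :=
        lintegral_mono fun σ => ENNReal.rpow_le_one_add_self _ (by norm_num) (by norm_num)
    _ = volume (Ioo 0 T) + ∫⁻ σ in Ioo 0 T, ∫⁻ x, ENNReal.ofReal (frobeniusNormSq (G σ x)) := by
        rw [lintegral_add_left measurable_const, lintegral_const, Measure.restrict_apply_univ, one_mul]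
    _ < ⊤ := ENNReal.add_lt_top.2 ⟨by rw [Real.volume_Ioo]; exact ENNReal.ofReal_lt_top, hG₂⟩

/-- **Integrability of the trilinear flux on the time square.** For a Leray–Hopf solution `u`
(dimension `3`, jointly measurable weak-gradient witness of finite dissipation), a jointly
measurable version `ũ`, and a jointly measurable gradient field `G` with `∫₀ᵀ∫|G|² < ∞`, the
function `(σ, s) ↦ ∫ ⟪G(σ) ũ(s), ũ(s)⟫` is integrable on `(0,T)²`: it is bounded by
`‖G(σ)‖₂ ‖ũ(s)‖₄²`, a product of two integrable functions. [folklore] -/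
theorem IsLerayHopfOn.integrable_sq_tri (hE3 : finrank ℝ E = 3) {f : ℝ → E → E}
    (hu : IsLerayHopfOn T ν f u₀ u) {Gu : ℝ → E → E →L[ℝ] E}
    (hGum : StronglyMeasurable (uncurry Gu))
    (hGu : ∀ᵐ t ∂(volume.restrict (Ioo 0 T)), HasWeakGradient (u t) (Gu t))
    (hGu₂ : ∫⁻ t in Ioo 0 T, ∫⁻ x, ENNReal.ofReal (frobeniusNormSq (Gu t x)) < ⊤)
    {ut : ℝ × E → E} (hutm : StronglyMeasurable ut)
    (hut : uncurry u =ᵐ[(volume.restrict (Ioo 0 T)).prod (volume : Measure E)] ut)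
    {G : ℝ → E → E →L[ℝ] E} (hGm : StronglyMeasurable (uncurry G))
    (hG₂ : ∫⁻ t in Ioo 0 T, ∫⁻ x, ENNReal.ofReal (frobeniusNormSq (G t x)) < ⊤) :
    Integrable (fun p : ℝ × ℝ => ∫ x, ⟪G p.1 x (ut (p.2, x)), ut (p.2, x)⟫)
      ((volume.restrict (Ioo 0 T)).prod (volume.restrict (Ioo 0 T))) := by
  haveI : ENNReal.HolderTriple 4 4 2 := holderTriple_four_four_two
  set D : ℝ → ℝ≥0∞ := fun σ => ∫⁻ x, ENNReal.ofReal (frobeniusNormSq (G σ x)) with hD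
  set e4 : ℝ → ℝ≥0∞ := fun s => eLpNorm (fun x => ut (s, x)) 4 volume with he4
  -- integrable majorants
  have ha : Integrable (fun σ => (D σ ^ (1 / 2 : ℝ)).toReal) (volume.restrict (Ioo 0 T)) :=
    integrable_toReal_sqrt_dissipation hGm hG₂
  have hslice := ae_slice_eq_of_uncurry_ae_eq hut
  have he4m : Measurable e4 := FunctionSpaces.measurable_eLpNorm_slice (g := fun s x => ut (s, x)) hutm 4
  have he4u : ∀ᵐ s ∂(volume.restrict (Ioo 0 T)), e4 s = eLpNorm (u s) 4 volume := by
    filter_upwards [hslice] with s hs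
    exact eLpNorm_congr_ae hs.symm
  have hh : Integrable (fun s => (e4 s ^ (2 : ℝ)).toReal) (volume.restrict (Ioo 0 T)) := by
    refine integrable_toReal_of_lintegral_ne_top (he4m.pow_const _).aemeasurable (ne_of_lt ?_)
    calc ∫⁻ s in Ioo 0 T, e4 s ^ (2 : ℝ) = ∫⁻ s in Ioo 0 T, eLpNorm (u s) 4 volume ^ (2 : ℝ) :=
          lintegral_congr_ae (by filter_upwards [he4u] with s hs; rw [hs])
      _ < ⊤ := hu.lintegral_eLpNorm_four_sq_lt_top hE3 hGum hGu hGu₂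
  -- finiteness a.e. on the square
  have hDfin : ∀ᵐ σ ∂(volume.restrict (Ioo 0 T)), D σ < ⊤ :=
    ae_lt_top (measurable_lintegral_frobeniusNormSq hGm) hG₂.ne
  have h4fin : ∀ᵐ s ∂(volume.restrict (Ioo 0 T)), e4 s < ⊤ := by
    have h := ae_lt_top' ((FunctionSpaces.aemeasurable_eLpNorm_slice hu.aestronglyMeasurable_uncurry 4).pow_const
      (2 : ℝ)) (hu.lintegral_eLpNorm_four_sq_lt_top hE3 hGum hGu hGu₂).ne
    filter_upwards [h, he4u] with s hs hs'
    rw [hs']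
    exact (ENNReal.rpow_lt_top_iff_of_pos zero_lt_two).1 hs
  have hae : ∀ᵐ p ∂((volume.restrict (Ioo 0 T)).prod (volume.restrict (Ioo 0 T))),
      D p.1 < ⊤ ∧ e4 p.2 < ⊤ := by
    filter_upwards [(Measure.quasiMeasurePreserving_fst (μ := volume.restrict (Ioo 0 T))
      (ν := volume.restrict (Ioo 0 T))).ae hDfin,
      (Measure.quasiMeasurePreserving_snd (μ := volume.restrict (Ioo 0 T))
      (ν := volume.restrict (Ioo 0 T))).ae h4fin] with p h1 h2
    exact ⟨h1, h2⟩
  -- the bound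
  refine Integrable.mono' (ha.mul_prod hh)
    (stronglyMeasurable_integral_inner_apply hGm hutm hutm).aestronglyMeasurable ?_
  filter_upwards [hae] with p hp
  obtain ⟨hp1, hp2⟩ := hp
  have hGσ : AEStronglyMeasurable (G p.1) volume := (hGm.of_uncurry_left (x := p.1)).aestronglyMeasurable
  have hus : AEStronglyMeasurable (fun x => ut (p.2, x)) volume :=
    (hutm.comp_measurable (measurable_const.prodMk measurable_id)).aestronglyMeasurable
  have hb := (enorm_integral_le_lintegral_enorm _).trans
    (lintegral_enorm_inner_apply_le hGσ hus hus 4 4)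
  rw [← toReal_enorm]
  have hfin : D p.1 ^ (1 / 2 : ℝ) * (e4 p.2 * e4 p.2) ≠ ⊤ :=
    ENNReal.mul_ne_top (ENNReal.rpow_ne_top_of_nonneg (by norm_num) hp1.ne)
      (ENNReal.mul_ne_top hp2.ne hp2.ne)
  refine (ENNReal.toReal_mono hfin hb).trans (le_of_eq ?_)
  rw [ENNReal.toReal_mul, ENNReal.rpow_two, sq, ENNReal.toReal_mul]

/-- **Integrability of the gradient pairing on the time square**: `(σ,s) ↦ ∫ ⟪G₁(s)e, G₂(σ)e⟫`
is bounded by `‖G₁(s)‖₂ ‖G₂(σ)‖₂`, a product of two square-integrable (hence integrable on the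
bounded interval) functions. [folklore] -/
theorem integrable_sq_grad {G₁ G₂ : ℝ → E → E →L[ℝ] E}
    (hG₁m : StronglyMeasurable (uncurry G₁)) (hG₂m : StronglyMeasurable (uncurry G₂))
    (hG₁₂ : ∫⁻ t in Ioo 0 T, ∫⁻ x, ENNReal.ofReal (frobeniusNormSq (G₁ t x)) < ⊤)
    (hG₂₂ : ∫⁻ t in Ioo 0 T, ∫⁻ x, ENNReal.ofReal (frobeniusNormSq (G₂ t x)) < ⊤)
    (e : E) (he : ‖e‖ = 1) :
    Integrable (fun p : ℝ × ℝ => ∫ x, ⟪G₁ p.2 x e, G₂ p.1 x e⟫)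
      ((volume.restrict (Ioo 0 T)).prod (volume.restrict (Ioo 0 T))) := by
  set D₁ : ℝ → ℝ≥0∞ := fun s => ∫⁻ x, ENNReal.ofReal (frobeniusNormSq (G₁ s x)) with hD₁
  set D₂ : ℝ → ℝ≥0∞ := fun σ => ∫⁻ x, ENNReal.ofReal (frobeniusNormSq (G₂ σ x)) with hD₂
  have ha : Integrable (fun σ => (D₂ σ ^ (1 / 2 : ℝ)).toReal) (volume.restrict (Ioo 0 T)) :=
    integrable_toReal_sqrt_dissipation hG₂m hG₂₂
  have hb : Integrable (fun s => (D₁ s ^ (1 / 2 : ℝ)).toReal) (volume.restrict (Ioo 0 T)) :=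
    integrable_toReal_sqrt_dissipation hG₁m hG₁₂
  have h1fin : ∀ᵐ s ∂(volume.restrict (Ioo 0 T)), D₁ s < ⊤ :=
    ae_lt_top (measurable_lintegral_frobeniusNormSq hG₁m) hG₁₂.ne
  have h2fin : ∀ᵐ σ ∂(volume.restrict (Ioo 0 T)), D₂ σ < ⊤ :=
    ae_lt_top (measurable_lintegral_frobeniusNormSq hG₂m) hG₂₂.ne
  have hae : ∀ᵐ p ∂((volume.restrict (Ioo 0 T)).prod (volume.restrict (Ioo 0 T))),
      D₂ p.1 < ⊤ ∧ D₁ p.2 < ⊤ := by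
    filter_upwards [(Measure.quasiMeasurePreserving_fst (μ := volume.restrict (Ioo 0 T))
      (ν := volume.restrict (Ioo 0 T))).ae h2fin,
      (Measure.quasiMeasurePreserving_snd (μ := volume.restrict (Ioo 0 T))
      (ν := volume.restrict (Ioo 0 T))).ae h1fin] with p h1 h2
    exact ⟨h1, h2⟩
  refine Integrable.mono' (ha.mul_prod hb)
    (stronglyMeasurable_integral_inner_grad hG₁m hG₂m e).aestronglyMeasurable ?_
  filter_upwards [hae] with p hp
  obtain ⟨hp1, hp2⟩ := hp
  have hm1 : AEStronglyMeasurable (G₁ p.2) volume := (hG₁m.of_uncurry_left (x := p.2)).aestronglyMeasurable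
  have hm2 : AEStronglyMeasurable (G₂ p.1) volume := (hG₂m.of_uncurry_left (x := p.1)).aestronglyMeasurable
  have hbd := enorm_integral_inner_apply_apply_le (G₁ p.2) (G₂ p.1) hm1 hm2 e he
  have hc : eLpNorm (fun x => G₁ p.2 x e) 2 volume ≤ D₁ p.2 ^ (1 / 2 : ℝ) :=
    eLpNorm_apply_le_lintegral_frobenius_rpow (G₁ p.2) e he
  rw [← toReal_enorm]
  have hfin : D₂ p.1 ^ (1 / 2 : ℝ) * D₁ p.2 ^ (1 / 2 : ℝ) ≠ ⊤ :=
    ENNReal.mul_ne_top (ENNReal.rpow_ne_top_of_nonneg (by norm_num) hp1.ne)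
      (ENNReal.rpow_ne_top_of_nonneg (by norm_num) hp2.ne)
  refine (ENNReal.toReal_mono hfin (hbd.trans ?_)).trans (le_of_eq ?_)
  · calc eLpNorm (fun x => G₁ p.2 x e) 2 volume * D₂ p.1 ^ (1 / 2 : ℝ)
        ≤ D₁ p.2 ^ (1 / 2 : ℝ) * D₂ p.1 ^ (1 / 2 : ℝ) := mul_le_mul' hc le_rfl
      _ = D₂ p.1 ^ (1 / 2 : ℝ) * D₁ p.2 ^ (1 / 2 : ℝ) := mul_comm _ _
  · rw [ENNReal.toReal_mul]

end Square

/-! ### Space–time memberships of the versions -/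

section SpaceTime

variable {T ν : ℝ} {u₀ : E → E} {u : ℝ → E → E}

/-- `‖v‖²_{L²((0,T) × E)} = ∫₀ᵀ ∫ |ṽ|²` is finite for (a jointly measurable version of) a
Leray–Hopf solution, by the `L^∞(0,T;L²)` clause. [folklore] -/
theorem IsLerayHopfOn.eLpNorm_two_version_lt_top {f : ℝ → E → E} (hu : IsLerayHopfOn T ν f u₀ u)
    {ut : ℝ × E → E} (hutm : StronglyMeasurable ut)
    (hut : uncurry u =ᵐ[(volume.restrict (Ioo 0 T)).prod (volume : Measure E)] ut) :
    eLpNorm ut 2 ((volume.restrict (Ioo 0 T)).prod (volume : Measure E)) < ⊤ := by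
  obtain ⟨C, hC⟩ := hu.energy_bound
  have hslice := ae_slice_eq_of_uncurry_ae_eq hut
  have hsq := FunctionSpaces.lintegral_eLpNorm_slice_sq (μ := (volume : Measure E))
    (ν := volume.restrict (Ioo 0 T)) (A := fun s x => ut (s, x)) hutm
  have hbound : ∫⁻ s in Ioo 0 T, eLpNorm (fun x => ut (s, x)) 2 volume ^ (2 : ℝ) ≤ C * volume (Ioo 0 T) := by
    calc ∫⁻ s in Ioo 0 T, eLpNorm (fun x => ut (s, x)) 2 volume ^ (2 : ℝ)
        ≤ ∫⁻ s in Ioo 0 T, (C : ℝ≥0∞) := by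
          refine lintegral_mono_ae ?_
          filter_upwards [hC, hslice] with s hs hsl
          rw [eLpNorm_congr_ae hsl.symm, ENNReal.rpow_two, ← eEnergy_eq_eLpNorm_sq]
          exact hs
      _ = C * volume (Ioo 0 T) := by rw [lintegral_const, Measure.restrict_apply_univ]
  have hfin : eLpNorm (uncurry fun s x => ut (s, x)) 2
      ((volume.restrict (Ioo 0 T)).prod (volume : Measure E)) ^ (2 : ℝ) < ⊤ := by
    rw [← hsq]
    refine lt_of_le_of_lt hbound (ENNReal.mul_lt_top ENNReal.coe_lt_top ?_)
    rw [Real.volume_Ioo]; exact ENNReal.ofReal_lt_top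
  have : (uncurry fun s x => ut (s, x)) = ut := by ext p; rfl
  rw [this] at hfin
  exact (ENNReal.rpow_lt_top_iff_of_pos zero_lt_two).1 hfin

omit [MeasurableSpace E] [BorelSpace E] in
/-- `‖F‖_{L²} ≤ (∫ |F|²_{Frob})^{1/2}` for a field of linear maps on any measure space
(operator norm `≤` Frobenius norm). [folklore] -/
theorem eLpNorm_two_le_lintegral_frobenius_rpow_general {α : Type*} [MeasurableSpace α]
    (μ : Measure α) (F : α → E →L[ℝ] E) :
    eLpNorm F 2 μ ≤ (∫⁻ z, ENNReal.ofReal (frobeniusNormSq (F z)) ∂μ) ^ (1 / 2 : ℝ) := by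
  rw [eLpNorm_eq_lintegral_rpow_enorm_toReal two_ne_zero ENNReal.ofNat_ne_top, ENNReal.toReal_ofNat]
  gcongr with z
  exact enorm_sq_le_ofReal_frobeniusNormSq (F z)

/-- The operator-norm `L²((0,T) × E)` membership of a finite-dissipation gradient field. [folklore] -/
theorem memLp_two_grad_prod {G : ℝ → E → E →L[ℝ] E} (hGm : StronglyMeasurable (uncurry G))
    (hG₂ : ∫⁻ t in Ioo 0 T, ∫⁻ x, ENNReal.ofReal (frobeniusNormSq (G t x)) < ⊤) :
    MemLp (uncurry G) 2 ((volume.restrict (Ioo 0 T)).prod (volume : Measure E)) := by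
  refine ⟨hGm.aestronglyMeasurable, ?_⟩
  have h1 := eLpNorm_two_le_lintegral_frobenius_rpow_general
    ((volume.restrict (Ioo 0 T)).prod (volume : Measure E)) (uncurry G)
  have hfm : AEMeasurable (fun z : ℝ × E => ENNReal.ofReal (frobeniusNormSq (uncurry G z)))
      ((volume.restrict (Ioo 0 T)).prod (volume : Measure E)) :=
    (ENNReal.measurable_ofReal.comp
      (NSWeakStrongUniqueness.continuous_frobeniusNormSq.comp_stronglyMeasurable hGm).measurable).aemeasurable
  have h2 : ∫⁻ z, ENNReal.ofReal (frobeniusNormSq (uncurry G z))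
      ∂((volume.restrict (Ioo 0 T)).prod (volume : Measure E)) =
      ∫⁻ t in Ioo 0 T, ∫⁻ x, ENNReal.ofReal (frobeniusNormSq (G t x)) := lintegral_prod _ hfm
  rw [h2] at h1
  exact lt_of_le_of_lt h1 (ENNReal.rpow_lt_top_of_nonneg (by norm_num) hG₂.ne)

/-- The components `G eᵢ` of a finite-dissipation gradient field are in `L²((0,T) × E)`. [folklore] -/
theorem eLpNorm_grad_apply_prod_lt_top {G : ℝ → E → E →L[ℝ] E} (hGm : StronglyMeasurable (uncurry G))
    (hG₂ : ∫⁻ t in Ioo 0 T, ∫⁻ x, ENNReal.ofReal (frobeniusNormSq (G t x)) < ⊤) (e : E) (he : ‖e‖ = 1) :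
    eLpNorm (uncurry fun s x => G s x e) 2 ((volume.restrict (Ioo 0 T)).prod (volume : Measure E)) < ⊤ := by
  have h := memLp_two_grad_prod hGm hG₂
  refine lt_of_le_of_lt (eLpNorm_mono fun p => ?_) h.2
  calc ‖(uncurry fun s x => G s x e) p‖ = ‖G p.1 p.2 e‖ := rfl
    _ ≤ ‖G p.1 p.2‖ * ‖e‖ := (G p.1 p.2).le_opNorm e
    _ = ‖uncurry G p‖ := by rw [he, mul_one]; rfl

/-- **`G·ṽ ∈ L¹((0,T) × E)`**: the field `(σ,x) ↦ G(σ,x) ṽ(σ,x)` pairing a finite-dissipation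
gradient field with (a version of) a Leray–Hopf solution is integrable on the strip
(`|G ṽ| ≤ |G| |ṽ|`, Cauchy–Schwarz on the strip). [folklore] -/
theorem IsLerayHopfOn.integrable_grad_apply_version {f : ℝ → E → E} (hv : IsLerayHopfOn T ν f u₀ u)
    {vt : ℝ × E → E} (hvtm : StronglyMeasurable vt)
    (hvt : uncurry u =ᵐ[(volume.restrict (Ioo 0 T)).prod (volume : Measure E)] vt)
    {G : ℝ → E → E →L[ℝ] E} (hGm : StronglyMeasurable (uncurry G))
    (hG₂ : ∫⁻ t in Ioo 0 T, ∫⁻ x, ENNReal.ofReal (frobeniusNormSq (G t x)) < ⊤) :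
    Integrable (fun z : ℝ × E => G z.1 z.2 (vt z)) ((volume.restrict (Ioo 0 T)).prod (volume : Measure E)) := by
  have hG := memLp_two_grad_prod hGm hG₂
  have hV : MemLp vt 2 ((volume.restrict (Ioo 0 T)).prod (volume : Measure E)) :=
    ⟨hvtm.aestronglyMeasurable, hv.eLpNorm_two_version_lt_top hvtm hvt⟩
  have hprod : MemLp ((fun z => ‖uncurry G z‖) * fun z => ‖vt z‖) 1
      ((volume.restrict (Ioo 0 T)).prod (volume : Measure E)) := hV.norm.mul hG.norm
  rw [memLp_one_iff_integrable] at hprod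
  refine hprod.mono' (isBoundedBilinearMap_apply.continuous.comp_aestronglyMeasurable
    (hG.1.prodMk hV.1)) (ae_of_all _ fun z => ?_)
  calc ‖G z.1 z.2 (vt z)‖ ≤ ‖G z.1 z.2‖ * ‖vt z‖ := (G z.1 z.2).le_opNorm _
    _ = ((fun z => ‖uncurry G z‖) * fun z => ‖vt z‖) z := rfl

/-- **The truncated test fields `Φᵢᴹ = ⟪ũ, eᵢ⟫ ũ^{<M}`** are jointly measurable and in
`L²((0,T) × E)` with `‖Φᵢᴹ‖ ≤ M ‖ũ‖`. [folklore] -/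
theorem memLp_two_inner_smul_truncation {ut : ℝ × E → E} (hutm : StronglyMeasurable ut)
    (hut2 : eLpNorm ut 2 ((volume.restrict (Ioo 0 T)).prod (volume : Measure E)) < ⊤)
    (e : E) (he : ‖e‖ = 1) {M : ℝ} (hM : 0 ≤ M) :
    StronglyMeasurable (fun p : ℝ × E => ⟪ut p, e⟫ • {p | ‖ut p‖ < M}.indicator ut p) ∧
    eLpNorm (fun p : ℝ × E => ⟪ut p, e⟫ • {p | ‖ut p‖ < M}.indicator ut p) 2
      ((volume.restrict (Ioo 0 T)).prod (volume : Measure E)) < ⊤ := by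
  have hm : StronglyMeasurable (fun p : ℝ × E => ⟪ut p, e⟫ • {p | ‖ut p‖ < M}.indicator ut p) :=
    (hutm.inner stronglyMeasurable_const).smul (hutm.indicator_norm_lt M)
  refine ⟨hm, ?_⟩
  have hpt : ∀ p, ‖⟪ut p, e⟫ • {p | ‖ut p‖ < M}.indicator ut p‖ ≤ M * ‖ut p‖ := fun p => by
    rw [norm_smul]
    calc ‖⟪ut p, e⟫‖ * ‖{p | ‖ut p‖ < M}.indicator ut p‖ ≤ (‖ut p‖ * ‖e‖) * M :=
          mul_le_mul (norm_inner_le_norm (𝕜 := ℝ) _ _) (norm_indicator_norm_lt_le ut hM p)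
            (norm_nonneg _) (by positivity)
      _ = M * ‖ut p‖ := by rw [he, mul_one, mul_comm]
  calc eLpNorm (fun p : ℝ × E => ⟪ut p, e⟫ • {p | ‖ut p‖ < M}.indicator ut p) 2
        ((volume.restrict (Ioo 0 T)).prod (volume : Measure E))
      ≤ eLpNorm (fun p => M • ut p) 2 ((volume.restrict (Ioo 0 T)).prod (volume : Measure E)) := by
        refine eLpNorm_mono fun p => ?_
        calc ‖⟪ut p, e⟫ • {p | ‖ut p‖ < M}.indicator ut p‖ ≤ M * ‖ut p‖ := hpt p
          _ = ‖M • ut p‖ := by rw [norm_smul, Real.norm_eq_abs, abs_of_nonneg hM]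
    _ = ENNReal.ofReal M * eLpNorm ut 2 ((volume.restrict (Ioo 0 T)).prod (volume : Measure E)) := by
        rw [show (fun p => M • ut p) = M • ut from rfl, eLpNorm_const_smul, Real.enorm_eq_ofReal hM]
    _ < ⊤ := ENNReal.mul_lt_top ENNReal.ofReal_lt_top hut2

end SpaceTime

/-! ### The Serrin-class slices: conjugate exponent, tails, and the two remainders -/

section Serrin

variable {T ν : ℝ} {u₀ : E → E} {u : ℝ → E → E}

omit [InnerProductSpace ℝ E] [FiniteDimensional ℝ E] [MeasurableSpace E] [BorelSpace E] in
/-- Slices of the truncated version: `ũ^{≥M}(s, ·) = (ũ(s,·))^{≥M}`. [folklore] -/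
theorem indicator_le_norm_slice (ut : ℝ × E → E) (M s : ℝ) :
    (fun x => {p : ℝ × E | M ≤ ‖ut p‖}.indicator ut (s, x)) =
      {x | M ≤ ‖ut (s, x)‖}.indicator fun x => ut (s, x) := by
  funext x
  simp only [indicator_apply, mem_setOf_eq]

omit [InnerProductSpace ℝ E] [FiniteDimensional ℝ E] [MeasurableSpace E] [BorelSpace E] in
/-- Slices of the truncated version: `ũ^{<M}(s, ·) = (ũ(s,·))^{<M}`. [folklore] -/
theorem indicator_norm_lt_slice (ut : ℝ × E → E) (M s : ℝ) :
    (fun x => {p : ℝ × E | ‖ut p‖ < M}.indicator ut (s, x)) =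
      {x | ‖ut (s, x)‖ < M}.indicator fun x => ut (s, x) := by
  funext x
  simp only [indicator_apply, mem_setOf_eq]

/-- **Sobolev–interpolation bound of the conjugate slice norm.** In dimension `3`, for `3 < r`
and the conjugate space exponent `p = (2⁻¹ - r⁻¹)⁻¹` (`1/p + 1/r = 1/2`), a field `w ∈ L²` with
weak gradient `G` satisfies `‖w‖_p ≤ ‖w‖₂^{1-θ} (K_S ‖∇w‖₂)^θ`, `θ = 3/r`
(Robinson–Rodrigo–Sadowski 2016, proof of Lemma 8.18). [cite: RobinsonRodrigoSadowski2016, proof of Lemma 8.18] -/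
theorem eLpNorm_conj_le_of_hasWeakGradient (hE3 : finrank ℝ E = 3) {r : ℝ≥0∞} (hr : 3 < r)
    {w : E → E} {G : E → E →L[ℝ] E} (hw2 : MemLp w 2 volume) (hw : HasWeakGradient w G) :
    eLpNorm w ((2⁻¹ - r⁻¹)⁻¹) volume ≤ eLpNorm w 2 volume ^ (1 - ((3 : ℝ≥0∞) / r).toReal) *
      ((SNormLESNormFDerivOfEqConst E (volume : Measure E) 2 : ℝ≥0∞) *
        (∫⁻ x, ENNReal.ofReal (frobeniusNormSq (G x))) ^ (1 / 2 : ℝ)) ^ ((3 : ℝ≥0∞) / r).toReal := by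
  obtain ⟨h2p, hp6, hexp1, hexp2⟩ := conj_exponent_props hr
  have h := eLpNorm_le_of_hasWeakGradient hE3 hw2 hw h2p hp6
  rwa [hexp1, hexp2] at h

/-- **The Serrin exponent numerics**: `θ = 3/r ∈ [0,1)` for `3 < r ≤ ∞`; the sharp Serrin time
exponent `q₀ = 2/(1-θ)` satisfies `ofReal q₀ ≤ q` whenever `2/q + 3/r ≤ 1`
(Robinson–Rodrigo–Sadowski 2016, (8.10)). [cite: RobinsonRodrigoSadowski2016, (8.10)] -/
theorem serrin_exponent_props {q r : ℝ≥0∞} (hr : 3 < r) (hqr : 2 / q + 3 / r ≤ 1) :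
    0 ≤ ((3 : ℝ≥0∞) / r).toReal ∧ ((3 : ℝ≥0∞) / r).toReal < 1 ∧
      ENNReal.ofReal (2 / (1 - ((3 : ℝ≥0∞) / r).toReal)) ≤ q := by
  have hr0 : r ≠ 0 := by rintro rfl; simp at hr
  have h3r : (3 : ℝ≥0∞) / r < 1 :=
    (ENNReal.div_lt_iff (Or.inl hr0) (Or.inr (ENNReal.ofNat_ne_top (n := 3)))).2
      (by simpa using hr)
  have h3r_top : (3 : ℝ≥0∞) / r ≠ ⊤ := (h3r.trans ENNReal.one_lt_top).ne
  set θ : ℝ := ((3 : ℝ≥0∞) / r).toReal with hθ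
  have hθ0 : 0 ≤ θ := ENNReal.toReal_nonneg
  have hθ1 : θ < 1 := by
    have h := (ENNReal.toReal_lt_toReal h3r_top ENNReal.one_ne_top).2 h3r
    rw [ENNReal.toReal_one] at h
    exact h
  refine ⟨hθ0, hθ1, ?_⟩
  rcases eq_or_ne q ⊤ with rfl | hqtop
  · exact le_top
  have h2q : 2 / q ≤ ENNReal.ofReal (1 - θ) := by
    have := ENNReal.le_sub_of_add_le_right h3r_top hqr
    rwa [← ENNReal.ofReal_toReal h3r_top, ← hθ, ← ENNReal.ofReal_one,
      ← ENNReal.ofReal_sub _ hθ0] at this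
  have hq0 : q ≠ 0 := by
    rintro rfl
    rw [ENNReal.div_zero two_ne_zero] at h2q
    exact absurd h2q (not_le.2 ENNReal.ofReal_lt_top)
  rw [ENNReal.div_le_iff hq0 hqtop] at h2q
  have h2q' : (2 : ℝ) ≤ (1 - θ) * q.toReal := by
    have := ENNReal.toReal_mono (ENNReal.mul_ne_top ENNReal.ofReal_ne_top hqtop) h2q
    rwa [ENNReal.toReal_mul, ENNReal.toReal_ofReal (by linarith), ENNReal.toReal_ofNat] at this
  refine ENNReal.ofReal_le_of_le_toReal ?_
  rw [div_le_iff₀ (by linarith)]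
  linarith

/-- **The `L^r` tails of the Serrin-class solution vanish in `L^{q₀}(0,T)`**: with
`m_M(s) = ‖(ũ(s))^{≥M}‖_{L^r}`, `∫₀ᵀ m_M^{q₀} → 0` as `M → ∞` (dominated convergence in time:
`m_M ≤ ‖u(s)‖_r ∈ L^{q₀}(0,T)` by the Serrin condition, and `m_M(s) → 0` for a.e. `s`). [folklore] -/
theorem tendsto_lintegral_tail_rpow {q r : ℝ≥0∞} (hr : 3 < r) (hqr : 2 / q + 3 / r ≤ 1) (hS : MemLqLp q r u (Ioo 0 T))
    {ut : ℝ × E → E} (hutm : StronglyMeasurable ut)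
    (hut : uncurry u =ᵐ[(volume.restrict (Ioo 0 T)).prod (volume : Measure E)] ut) :
    Tendsto (fun M : ℕ => ∫⁻ s in Ioo 0 T,
      eLpNorm ({x | (M : ℝ) ≤ ‖ut (s, x)‖}.indicator fun x => ut (s, x)) r volume ^
        (2 / (1 - ((3 : ℝ≥0∞) / r).toReal))) atTop (𝓝 0) := by
  obtain ⟨hθ0, hθ1, hρq⟩ := serrin_exponent_props hr hqr
  set θ : ℝ := ((3 : ℝ≥0∞) / r).toReal with hθ
  set q₀ : ℝ := 2 / (1 - θ) with hq₀
  have hq₀0 : 0 < q₀ := div_pos two_pos (by linarith)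
  have hslice := ae_slice_eq_of_uncurry_ae_eq hut
  -- measurability of the tails in time
  have hmM : ∀ M : ℕ, Measurable fun s =>
      eLpNorm ({x | (M : ℝ) ≤ ‖ut (s, x)‖}.indicator fun x => ut (s, x)) r volume := by
    intro M
    have hmeas : StronglyMeasurable
        (uncurry fun s x => {p : ℝ × E | (M : ℝ) ≤ ‖ut p‖}.indicator ut (s, x)) := by
      have : (uncurry fun s x => {p : ℝ × E | (M : ℝ) ≤ ‖ut p‖}.indicator ut (s, x)) =
          {p : ℝ × E | (M : ℝ) ≤ ‖ut p‖}.indicator ut := by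
        ext p; rfl
      rw [this]
      exact hutm.indicator_le_norm (M : ℝ)
    have h := FunctionSpaces.measurable_eLpNorm_slice (μ := (volume : Measure E))
      (g := fun s x => {p : ℝ × E | (M : ℝ) ≤ ‖ut p‖}.indicator ut (s, x)) hmeas r
    simpa only [indicator_le_norm_slice] using h
  have hN : Measurable fun s => eLpNorm (fun x => ut (s, x)) r volume :=
    FunctionSpaces.measurable_eLpNorm_slice (g := fun s x => ut (s, x)) hutm r
  -- domination and finiteness
  have hdom : ∀ M : ℕ, ∀ s, eLpNorm ({x | (M : ℝ) ≤ ‖ut (s, x)‖}.indicator fun x => ut (s, x)) r volume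
      ^ q₀ ≤ eLpNorm (fun x => ut (s, x)) r volume ^ q₀ := fun M s =>
    ENNReal.rpow_le_rpow (eLpNorm_mono fun x => norm_indicator_le_norm_self _ _) hq₀0.le
  have hfin : ∫⁻ s in Ioo 0 T, eLpNorm (fun x => ut (s, x)) r volume ^ q₀ ≠ ⊤ := by
    have hvol : volume (Ioo 0 T) ≠ ⊤ := by rw [Real.volume_Ioo]; exact ENNReal.ofReal_ne_top
    have h := FluidPDE.lintegral_rpow_eLpNorm_lt_top hvol hS hq₀0.le hρq
    refine ne_of_lt (lt_of_le_of_lt (le_of_eq ?_) h)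
    refine lintegral_congr_ae ?_
    filter_upwards [hslice] with s hs
    rw [eLpNorm_congr_ae hs]
  -- pointwise convergence for a.e. `s`
  have hlim : ∀ᵐ s ∂(volume.restrict (Ioo 0 T)), Tendsto (fun M : ℕ =>
      eLpNorm ({x | (M : ℝ) ≤ ‖ut (s, x)‖}.indicator fun x => ut (s, x)) r volume ^ q₀)
      atTop (𝓝 0) := by
    filter_upwards [hS.1, hslice] with s hsr hs
    have hmem : MemLp (fun x => ut (s, x)) r volume := hsr.ae_eq hs
    have h := tendsto_eLpNorm_indicator_le_norm hmem
      (hutm.comp_measurable (measurable_const.prodMk measurable_id))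
    have := ((ENNReal.continuous_rpow_const (y := q₀)).tendsto (0 : ℝ≥0∞)).comp h
    rwa [ENNReal.zero_rpow_of_pos hq₀0] at this
  have h := tendsto_lintegral_of_dominated_convergence
    (μ := volume.restrict (Ioo 0 T)) (fun s => eLpNorm (fun x => ut (s, x)) r volume ^ q₀)
    (fun M => (hmM M).pow_const _) (fun M => ae_of_all _ (hdom M)) hfin hlim
  simpa only [lintegral_zero] using h

/-- **Pointwise bound of the truncation remainder (A-side)**:
`|∫ ⟪G(σ) ũ(s), ũ^{≥M}(s)⟫| ≤ ‖G(σ)‖₂ ‖ũ(s)‖_p m_M(s)`, `1/p + 1/r = 1/2` (three-factor Hölder). [folklore] -/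
theorem enorm_integral_inner_apply_tail_le {r : ℝ≥0∞} (hr : 3 < r)
    {G : ℝ → E → E →L[ℝ] E} (hGm : StronglyMeasurable (uncurry G))
    {ut : ℝ × E → E} (hutm : StronglyMeasurable ut) (M σ s : ℝ) :
    ‖∫ x, ⟪G σ x (ut (s, x)), {x | M ≤ ‖ut (s, x)‖}.indicator (fun x => ut (s, x)) x⟫‖ₑ ≤
      (∫⁻ x, ENNReal.ofReal (frobeniusNormSq (G σ x))) ^ (1 / 2 : ℝ) *
        (eLpNorm (fun x => ut (s, x)) ((2⁻¹ - r⁻¹)⁻¹) volume *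
          eLpNorm ({x | M ≤ ‖ut (s, x)‖}.indicator fun x => ut (s, x)) r volume) := by
  haveI := holderTriple_conj_two (r := r) (le_trans (by norm_num) hr.le)
  have hGσ : AEStronglyMeasurable (G σ) volume := (hGm.of_uncurry_left (x := σ)).aestronglyMeasurable
  have hus : StronglyMeasurable (fun x => ut (s, x)) :=
    hutm.comp_measurable (measurable_const.prodMk measurable_id)
  have hind : AEStronglyMeasurable ({x | M ≤ ‖ut (s, x)‖}.indicator fun x => ut (s, x)) volume :=
    (hus.indicator (measurableSet_le measurable_const hus.norm.measurable)).aestronglyMeasurable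
  exact (enorm_integral_le_lintegral_enorm _).trans
    (lintegral_enorm_inner_apply_le hGσ hus.aestronglyMeasurable hind _ _)

/-- **Pointwise bound of the truncation remainder (B-side)**:
`|∫ ⟪ũ^{≥M}(s), G(σ) ṽ(σ)⟫| ≤ ‖G(σ)‖₂ ‖ṽ(σ)‖_p m_M(s)`. [folklore] -/
theorem enorm_integral_inner_tail_apply_le {r : ℝ≥0∞} (hr : 3 < r)
    {G : ℝ → E → E →L[ℝ] E} (hGm : StronglyMeasurable (uncurry G))
    {ut vt : ℝ × E → E} (hutm : StronglyMeasurable ut) (hvtm : StronglyMeasurable vt) (M σ s : ℝ) :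
    ‖∫ x, ⟪{x | M ≤ ‖ut (s, x)‖}.indicator (fun x => ut (s, x)) x, G σ x (vt (σ, x))⟫‖ₑ ≤
      (∫⁻ x, ENNReal.ofReal (frobeniusNormSq (G σ x))) ^ (1 / 2 : ℝ) *
        (eLpNorm (fun x => vt (σ, x)) ((2⁻¹ - r⁻¹)⁻¹) volume *
          eLpNorm ({x | M ≤ ‖ut (s, x)‖}.indicator fun x => ut (s, x)) r volume) := by
  haveI := holderTriple_conj_two (r := r) (le_trans (by norm_num) hr.le)
  have hGσ : AEStronglyMeasurable (G σ) volume := (hGm.of_uncurry_left (x := σ)).aestronglyMeasurable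
  have hus : StronglyMeasurable (fun x => ut (s, x)) :=
    hutm.comp_measurable (measurable_const.prodMk measurable_id)
  have hvs : AEStronglyMeasurable (fun x => vt (σ, x)) volume :=
    (hvtm.comp_measurable (measurable_const.prodMk measurable_id)).aestronglyMeasurable
  have hind : AEStronglyMeasurable ({x | M ≤ ‖ut (s, x)‖}.indicator fun x => ut (s, x)) volume :=
    (hus.indicator (measurableSet_le measurable_const hus.norm.measurable)).aestronglyMeasurable
  rw [integral_inner_comm]
  exact (enorm_integral_le_lintegral_enorm _).trans
    (lintegral_enorm_inner_apply_le hGσ hvs hind _ _)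

/-- **The A-side remainder, uniformly in the mollification** (weighted Hölder with exponents
`(2,2)`): `∫∫ ρ(s-σ) |∫⟪G(σ)ũ(s), ũ^{≥M}(s)⟫| ≤ (∫‖G‖₂²)^{1/2} (∫ (‖ũ‖_p m_M)²)^{1/2}`
(Serrin 1963, §4). [cite: Serrin1963, §4] -/
theorem remainderA_le (φ : ContDiffBump (0 : ℝ)) {t : ℝ} {r : ℝ≥0∞} (hr : 3 < r)
    {G : ℝ → E → E →L[ℝ] E} (hGm : StronglyMeasurable (uncurry G))
    {ut : ℝ × E → E} (hutm : StronglyMeasurable ut) (M : ℝ) :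
    ∫⁻ σ in Ioo 0 t, ∫⁻ s in Ioo 0 t, ENNReal.ofReal (φ.normed volume (s - σ)) *
      ‖∫ x, ⟪G σ x (ut (s, x)), {x | M ≤ ‖ut (s, x)‖}.indicator (fun x => ut (s, x)) x⟫‖ₑ ≤
      (∫⁻ σ in Ioo 0 t, ∫⁻ x, ENNReal.ofReal (frobeniusNormSq (G σ x))) ^ (1 / 2 : ℝ) *
        (∫⁻ s in Ioo 0 t, (eLpNorm (fun x => ut (s, x)) ((2⁻¹ - r⁻¹)⁻¹) volume *
          eLpNorm ({x | M ≤ ‖ut (s, x)‖}.indicator fun x => ut (s, x)) r volume) ^ (2 : ℝ))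
          ^ (1 / 2 : ℝ) := by
  set D : ℝ → ℝ≥0∞ := fun σ => ∫⁻ x, ENNReal.ofReal (frobeniusNormSq (G σ x)) with hD
  set g : ℝ → ℝ≥0∞ := fun s => eLpNorm (fun x => ut (s, x)) ((2⁻¹ - r⁻¹)⁻¹) volume *
    eLpNorm ({x | M ≤ ‖ut (s, x)‖}.indicator fun x => ut (s, x)) r volume with hg
  have hDm : Measurable D := measurable_lintegral_frobeniusNormSq hGm
  have hgm : Measurable g := by
    refine (FunctionSpaces.measurable_eLpNorm_slice (g := fun s x => ut (s, x)) hutm _).mul ?_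
    have hmeas : StronglyMeasurable
        (uncurry fun s x => {p : ℝ × E | M ≤ ‖ut p‖}.indicator ut (s, x)) := by
      have : (uncurry fun s x => {p : ℝ × E | M ≤ ‖ut p‖}.indicator ut (s, x)) =
          {p : ℝ × E | M ≤ ‖ut p‖}.indicator ut := by ext p; rfl
      rw [this]; exact hutm.indicator_le_norm M
    have h := FunctionSpaces.measurable_eLpNorm_slice (μ := (volume : Measure E))
      (g := fun s x => {p : ℝ × E | M ≤ ‖ut p‖}.indicator ut (s, x)) hmeas r
    simpa only [indicator_le_norm_slice] using h
  calc ∫⁻ σ in Ioo 0 t, ∫⁻ s in Ioo 0 t, ENNReal.ofReal (φ.normed volume (s - σ)) *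
        ‖∫ x, ⟪G σ x (ut (s, x)), {x | M ≤ ‖ut (s, x)‖}.indicator (fun x => ut (s, x)) x⟫‖ₑ
      ≤ ∫⁻ σ in Ioo 0 t, ∫⁻ s in Ioo 0 t, ENNReal.ofReal (φ.normed volume (s - σ)) *
          (D σ ^ (1 / 2 : ℝ) * g s) := by
        refine lintegral_mono fun σ => lintegral_mono fun s => ?_
        exact mul_le_mul' le_rfl (enorm_integral_inner_apply_tail_le hr hGm hutm M σ s)
    _ ≤ (∫⁻ σ in Ioo 0 t, (D σ ^ (1 / 2 : ℝ)) ^ (2 : ℝ)) ^ (1 / (2 : ℝ)) *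
          (∫⁻ s in Ioo 0 t, g s ^ (2 : ℝ)) ^ (1 / (2 : ℝ)) :=
        FunctionSpaces.lintegral_lintegral_normed_mul_mul_le φ Measure.restrict_le_self Measure.restrict_le_self
          (hDm.pow_const _).aemeasurable hgm.aemeasurable Real.HolderConjugate.two_two
    _ = (∫⁻ σ in Ioo 0 t, D σ) ^ (1 / 2 : ℝ) * (∫⁻ s in Ioo 0 t, g s ^ (2 : ℝ)) ^ (1 / 2 : ℝ) := by
        congr 2
        refine lintegral_congr fun σ => ?_
        rw [← ENNReal.rpow_mul]; norm_num

/-- **The A-side remainder on the diagonal** (Cauchy–Schwarz in time):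
`∫ |∫⟪G(s)ũ(s), ũ^{≥M}(s)⟫| ≤ (∫‖G‖₂²)^{1/2} (∫ (‖ũ‖_p m_M)²)^{1/2}`. [folklore] -/
theorem remainderA_diag_le {t : ℝ} {r : ℝ≥0∞} (hr : 3 < r)
    {G : ℝ → E → E →L[ℝ] E} (hGm : StronglyMeasurable (uncurry G))
    {ut : ℝ × E → E} (hutm : StronglyMeasurable ut) (M : ℝ) :
    ∫⁻ s in Ioo 0 t,
      ‖∫ x, ⟪G s x (ut (s, x)), {x | M ≤ ‖ut (s, x)‖}.indicator (fun x => ut (s, x)) x⟫‖ₑ ≤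
      (∫⁻ σ in Ioo 0 t, ∫⁻ x, ENNReal.ofReal (frobeniusNormSq (G σ x))) ^ (1 / 2 : ℝ) *
        (∫⁻ s in Ioo 0 t, (eLpNorm (fun x => ut (s, x)) ((2⁻¹ - r⁻¹)⁻¹) volume *
          eLpNorm ({x | M ≤ ‖ut (s, x)‖}.indicator fun x => ut (s, x)) r volume) ^ (2 : ℝ))
          ^ (1 / 2 : ℝ) := by
  set D : ℝ → ℝ≥0∞ := fun σ => ∫⁻ x, ENNReal.ofReal (frobeniusNormSq (G σ x)) with hD
  set g : ℝ → ℝ≥0∞ := fun s => eLpNorm (fun x => ut (s, x)) ((2⁻¹ - r⁻¹)⁻¹) volume *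
    eLpNorm ({x | M ≤ ‖ut (s, x)‖}.indicator fun x => ut (s, x)) r volume with hg
  have hDm : Measurable D := measurable_lintegral_frobeniusNormSq hGm
  have hgm : Measurable g := by
    refine (FunctionSpaces.measurable_eLpNorm_slice (g := fun s x => ut (s, x)) hutm _).mul ?_
    have hmeas : StronglyMeasurable
        (uncurry fun s x => {p : ℝ × E | M ≤ ‖ut p‖}.indicator ut (s, x)) := by
      have : (uncurry fun s x => {p : ℝ × E | M ≤ ‖ut p‖}.indicator ut (s, x)) =
          {p : ℝ × E | M ≤ ‖ut p‖}.indicator ut := by ext p; rfl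
      rw [this]; exact hutm.indicator_le_norm M
    have h := FunctionSpaces.measurable_eLpNorm_slice (μ := (volume : Measure E))
      (g := fun s x => {p : ℝ × E | M ≤ ‖ut p‖}.indicator ut (s, x)) hmeas r
    simpa only [indicator_le_norm_slice] using h
  calc ∫⁻ s in Ioo 0 t,
        ‖∫ x, ⟪G s x (ut (s, x)), {x | M ≤ ‖ut (s, x)‖}.indicator (fun x => ut (s, x)) x⟫‖ₑ
      ≤ ∫⁻ s in Ioo 0 t, D s ^ (1 / 2 : ℝ) * g s :=
        lintegral_mono fun s => enorm_integral_inner_apply_tail_le hr hGm hutm M s s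
    _ ≤ (∫⁻ s in Ioo 0 t, (D s ^ (1 / 2 : ℝ)) ^ (2 : ℝ)) ^ (1 / (2 : ℝ)) *
          (∫⁻ s in Ioo 0 t, g s ^ (2 : ℝ)) ^ (1 / (2 : ℝ)) :=
        ENNReal.lintegral_mul_le_Lp_mul_Lq _ Real.HolderConjugate.two_two
          (hDm.pow_const _).aemeasurable hgm.aemeasurable
    _ = (∫⁻ σ in Ioo 0 t, D σ) ^ (1 / 2 : ℝ) * (∫⁻ s in Ioo 0 t, g s ^ (2 : ℝ)) ^ (1 / 2 : ℝ) := by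
        congr 2
        refine lintegral_congr fun σ => ?_
        rw [← ENNReal.rpow_mul]; norm_num

/-- The conjugate Serrin time exponents `q₀' = 2/(1+θ)`, `q₀ = 2/(1-θ)`, `0 ≤ θ < 1`. [folklore] -/
theorem holderConjugate_serrin {θ : ℝ} (hθ0 : 0 ≤ θ) (hθ1 : θ < 1) :
    (2 / (1 + θ)).HolderConjugate (2 / (1 - θ)) := by
  rw [Real.holderConjugate_iff]
  refine ⟨?_, ?_⟩
  · rw [lt_div_iff₀ (by linarith)]; linarith
  · rw [inv_div, inv_div]; field_simp; ring

/-- **The B-side remainder, uniformly in the mollification** (weighted Hölder with the conjugate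
Serrin time exponents `(2/(1+θ), 2/(1-θ))`):
`∫∫ ρ(s-σ) |∫⟪ũ^{≥M}(s), G(σ)ṽ(σ)⟫| ≤ ‖N‖_{2/(1+θ)} ‖m_M‖_{2/(1-θ)}`,
`N(σ) = ‖G(σ)‖₂ ‖ṽ(σ)‖_p` (Serrin 1963, §4; RRS 2016, proof of Lemma 8.18). [cite: Serrin1963, §4] -/
theorem remainderB_le (φ : ContDiffBump (0 : ℝ)) {t : ℝ} {r : ℝ≥0∞} (hr : 3 < r)
    (hθ1 : ((3 : ℝ≥0∞) / r).toReal < 1)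
    {G : ℝ → E → E →L[ℝ] E} (hGm : StronglyMeasurable (uncurry G))
    {ut vt : ℝ × E → E} (hutm : StronglyMeasurable ut) (hvtm : StronglyMeasurable vt) (M : ℝ) :
    ∫⁻ σ in Ioo 0 t, ∫⁻ s in Ioo 0 t, ENNReal.ofReal (φ.normed volume (s - σ)) *
      ‖∫ x, ⟪{x | M ≤ ‖ut (s, x)‖}.indicator (fun x => ut (s, x)) x, G σ x (vt (σ, x))⟫‖ₑ ≤
      (∫⁻ σ in Ioo 0 t, ((∫⁻ x, ENNReal.ofReal (frobeniusNormSq (G σ x))) ^ (1 / 2 : ℝ) *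
        eLpNorm (fun x => vt (σ, x)) ((2⁻¹ - r⁻¹)⁻¹) volume) ^ (2 / (1 + ((3 : ℝ≥0∞) / r).toReal)))
          ^ (1 / (2 / (1 + ((3 : ℝ≥0∞) / r).toReal))) *
        (∫⁻ s in Ioo 0 t, eLpNorm ({x | M ≤ ‖ut (s, x)‖}.indicator fun x => ut (s, x)) r volume
          ^ (2 / (1 - ((3 : ℝ≥0∞) / r).toReal))) ^ (1 / (2 / (1 - ((3 : ℝ≥0∞) / r).toReal))) := by
  set θ : ℝ := ((3 : ℝ≥0∞) / r).toReal with hθ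
  have hθ0 : 0 ≤ θ := ENNReal.toReal_nonneg
  set N : ℝ → ℝ≥0∞ := fun σ => (∫⁻ x, ENNReal.ofReal (frobeniusNormSq (G σ x))) ^ (1 / 2 : ℝ) *
    eLpNorm (fun x => vt (σ, x)) ((2⁻¹ - r⁻¹)⁻¹) volume with hN
  set m : ℝ → ℝ≥0∞ := fun s =>
    eLpNorm ({x | M ≤ ‖ut (s, x)‖}.indicator fun x => ut (s, x)) r volume with hm
  have hNm : Measurable N :=
    ((measurable_lintegral_frobeniusNormSq hGm).pow_const _).mul
      (FunctionSpaces.measurable_eLpNorm_slice (g := fun s x => vt (s, x)) hvtm _)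
  have hmm : Measurable m := by
    have hmeas : StronglyMeasurable
        (uncurry fun s x => {p : ℝ × E | M ≤ ‖ut p‖}.indicator ut (s, x)) := by
      have : (uncurry fun s x => {p : ℝ × E | M ≤ ‖ut p‖}.indicator ut (s, x)) =
          {p : ℝ × E | M ≤ ‖ut p‖}.indicator ut := by ext p; rfl
      rw [this]; exact hutm.indicator_le_norm M
    have h := FunctionSpaces.measurable_eLpNorm_slice (μ := (volume : Measure E))
      (g := fun s x => {p : ℝ × E | M ≤ ‖ut p‖}.indicator ut (s, x)) hmeas r
    simpa only [indicator_le_norm_slice] using h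
  calc ∫⁻ σ in Ioo 0 t, ∫⁻ s in Ioo 0 t, ENNReal.ofReal (φ.normed volume (s - σ)) *
        ‖∫ x, ⟪{x | M ≤ ‖ut (s, x)‖}.indicator (fun x => ut (s, x)) x, G σ x (vt (σ, x))⟫‖ₑ
      ≤ ∫⁻ σ in Ioo 0 t, ∫⁻ s in Ioo 0 t, ENNReal.ofReal (φ.normed volume (s - σ)) * (N σ * m s) := by
        refine lintegral_mono fun σ => lintegral_mono fun s => mul_le_mul' le_rfl ?_
        have h := enorm_integral_inner_tail_apply_le hr hGm hutm hvtm M σ s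
        simpa only [hN, hm, mul_assoc] using h
    _ ≤ (∫⁻ σ in Ioo 0 t, N σ ^ (2 / (1 + θ))) ^ (1 / (2 / (1 + θ))) *
          (∫⁻ s in Ioo 0 t, m s ^ (2 / (1 - θ))) ^ (1 / (2 / (1 - θ))) :=
        FunctionSpaces.lintegral_lintegral_normed_mul_mul_le φ Measure.restrict_le_self Measure.restrict_le_self
          hNm.aemeasurable hmm.aemeasurable (holderConjugate_serrin hθ0 hθ1)

/-- **The B-side remainder on the diagonal** (Hölder in time with the conjugate Serrin exponents):
`∫ |∫⟪ũ^{≥M}(s), G(s)ṽ(s)⟫| ≤ ‖N‖_{2/(1+θ)} ‖m_M‖_{2/(1-θ)}`. [folklore] -/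
theorem remainderB_diag_le {t : ℝ} {r : ℝ≥0∞} (hr : 3 < r) (hθ1 : ((3 : ℝ≥0∞) / r).toReal < 1)
    {G : ℝ → E → E →L[ℝ] E} (hGm : StronglyMeasurable (uncurry G))
    {ut vt : ℝ × E → E} (hutm : StronglyMeasurable ut) (hvtm : StronglyMeasurable vt) (M : ℝ) :
    ∫⁻ s in Ioo 0 t,
      ‖∫ x, ⟪{x | M ≤ ‖ut (s, x)‖}.indicator (fun x => ut (s, x)) x, G s x (vt (s, x))⟫‖ₑ ≤
      (∫⁻ σ in Ioo 0 t, ((∫⁻ x, ENNReal.ofReal (frobeniusNormSq (G σ x))) ^ (1 / 2 : ℝ) *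
        eLpNorm (fun x => vt (σ, x)) ((2⁻¹ - r⁻¹)⁻¹) volume) ^ (2 / (1 + ((3 : ℝ≥0∞) / r).toReal)))
          ^ (1 / (2 / (1 + ((3 : ℝ≥0∞) / r).toReal))) *
        (∫⁻ s in Ioo 0 t, eLpNorm ({x | M ≤ ‖ut (s, x)‖}.indicator fun x => ut (s, x)) r volume
          ^ (2 / (1 - ((3 : ℝ≥0∞) / r).toReal))) ^ (1 / (2 / (1 - ((3 : ℝ≥0∞) / r).toReal))) := by
  set θ : ℝ := ((3 : ℝ≥0∞) / r).toReal with hθ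
  have hθ0 : 0 ≤ θ := ENNReal.toReal_nonneg
  set N : ℝ → ℝ≥0∞ := fun σ => (∫⁻ x, ENNReal.ofReal (frobeniusNormSq (G σ x))) ^ (1 / 2 : ℝ) *
    eLpNorm (fun x => vt (σ, x)) ((2⁻¹ - r⁻¹)⁻¹) volume with hN
  set m : ℝ → ℝ≥0∞ := fun s =>
    eLpNorm ({x | M ≤ ‖ut (s, x)‖}.indicator fun x => ut (s, x)) r volume with hm
  have hNm : Measurable N :=
    ((measurable_lintegral_frobeniusNormSq hGm).pow_const _).mul
      (FunctionSpaces.measurable_eLpNorm_slice (g := fun s x => vt (s, x)) hvtm _)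
  have hmm : Measurable m := by
    have hmeas : StronglyMeasurable
        (uncurry fun s x => {p : ℝ × E | M ≤ ‖ut p‖}.indicator ut (s, x)) := by
      have : (uncurry fun s x => {p : ℝ × E | M ≤ ‖ut p‖}.indicator ut (s, x)) =
          {p : ℝ × E | M ≤ ‖ut p‖}.indicator ut := by ext p; rfl
      rw [this]; exact hutm.indicator_le_norm M
    have h := FunctionSpaces.measurable_eLpNorm_slice (μ := (volume : Measure E))
      (g := fun s x => {p : ℝ × E | M ≤ ‖ut p‖}.indicator ut (s, x)) hmeas r
    simpa only [indicator_le_norm_slice] using h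
  calc ∫⁻ s in Ioo 0 t,
        ‖∫ x, ⟪{x | M ≤ ‖ut (s, x)‖}.indicator (fun x => ut (s, x)) x, G s x (vt (s, x))⟫‖ₑ
      ≤ ∫⁻ s in Ioo 0 t, N s * m s := by
        refine lintegral_mono fun s => ?_
        have h := enorm_integral_inner_tail_apply_le hr hGm hutm hvtm M s s
        simpa only [hN, hm, mul_assoc] using h
    _ ≤ (∫⁻ s in Ioo 0 t, N s ^ (2 / (1 + θ))) ^ (1 / (2 / (1 + θ))) *
          (∫⁻ s in Ioo 0 t, m s ^ (2 / (1 - θ))) ^ (1 / (2 / (1 - θ))) :=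
        ENNReal.lintegral_mul_le_Lp_mul_Lq _ (holderConjugate_serrin hθ0 hθ1)
          hNm.aemeasurable hmm.aemeasurable

/-- **The conjugate slice norm of a Leray–Hopf solution is controlled by the dissipation**:
for a.e. `s`, `‖ũ(s)‖_p ≤ (K^{1/2})^{1-θ} K_S^θ (∫|Gu(s)|²)^{θ/2}`, where `E(u(s)) ≤ K` a.e.
(RRS 2016, proof of Lemma 8.18). [cite: RobinsonRodrigoSadowski2016, proof of Lemma 8.18] -/
theorem IsLerayHopfOn.ae_eLpNorm_conj_version_le (hE3 : finrank ℝ E = 3) {f : ℝ → E → E}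
    (hu : IsLerayHopfOn T ν f u₀ u) {r : ℝ≥0∞} (hr : 3 < r) {Gu : ℝ → E → E →L[ℝ] E}
    (hGu : ∀ᵐ t ∂(volume.restrict (Ioo 0 T)), HasWeakGradient (u t) (Gu t))
    {ut : ℝ × E → E}
    (hut : uncurry u =ᵐ[(volume.restrict (Ioo 0 T)).prod (volume : Measure E)] ut)
    {K : ℝ≥0} (hK : ∀ᵐ t ∂(volume.restrict (Ioo 0 T)), eEnergy (u t) ≤ K) :
    ∀ᵐ s ∂(volume.restrict (Ioo 0 T)),
      eLpNorm (fun x => ut (s, x)) ((2⁻¹ - r⁻¹)⁻¹) volume ≤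
        ((K : ℝ≥0∞) ^ (1 / 2 : ℝ)) ^ (1 - ((3 : ℝ≥0∞) / r).toReal) *
          (SNormLESNormFDerivOfEqConst E (volume : Measure E) 2 : ℝ≥0∞) ^ ((3 : ℝ≥0∞) / r).toReal *
          (∫⁻ x, ENNReal.ofReal (frobeniusNormSq (Gu s x))) ^ (((3 : ℝ≥0∞) / r).toReal / 2) := by
  set θ : ℝ := ((3 : ℝ≥0∞) / r).toReal with hθ
  have hθ0 : 0 ≤ θ := ENNReal.toReal_nonneg
  have hθ1 : θ ≤ 1 := by
    have hr0 : r ≠ 0 := by rintro rfl; simp at hr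
    have h3r : (3 : ℝ≥0∞) / r ≤ 1 :=
      ((ENNReal.div_lt_iff (Or.inl hr0) (Or.inr (ENNReal.ofNat_ne_top (n := 3)))).2
        (by simpa using hr)).le
    have := ENNReal.toReal_mono ENNReal.one_ne_top h3r
    rwa [ENNReal.toReal_one] at this
  filter_upwards [hGu, hK, ae_restrict_mem measurableSet_Ioo, ae_slice_eq_of_uncurry_ae_eq hut]
    with s hGs hKs hsI hsl
  have hmem : MemLp (u s) 2 volume := hu.memLp s (Ioo_subset_Icc_self hsI)
  rw [eLpNorm_congr_ae hsl.symm]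
  refine (eLpNorm_conj_le_of_hasWeakGradient hE3 hr hmem hGs).trans ?_
  have h2 : eLpNorm (u s) 2 volume ≤ (K : ℝ≥0∞) ^ (1 / 2 : ℝ) := by
    rw [eEnergy_eq_eLpNorm_sq] at hKs
    calc eLpNorm (u s) 2 volume = (eLpNorm (u s) 2 volume ^ 2) ^ (1 / 2 : ℝ) := by
          rw [← ENNReal.rpow_natCast, ← ENNReal.rpow_mul]; norm_num
      _ ≤ (K : ℝ≥0∞) ^ (1 / 2 : ℝ) := ENNReal.rpow_le_rpow hKs (by norm_num)
  rw [ENNReal.mul_rpow_of_nonneg _ _ hθ0, ← ENNReal.rpow_mul,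
    show (1 : ℝ) / 2 * θ = θ / 2 by ring, ← mul_assoc]
  gcongr ?_ * _ * _
  · exact ENNReal.rpow_le_rpow h2 (by linarith)

/-- **The A-side tail functional vanishes**: `∫₀ᵀ (‖ũ(s)‖_p m_M(s))² ds → 0` as `M → ∞`
(the Serrin condition: `‖ũ‖_p ≤ C‖∇u‖₂^θ`, `m_M ∈ L^{2/(1-θ)} → 0`, Hölder in time with
exponents `θ + (1-θ) = 1`; RRS 2016, proof of Lemma 8.18 / Thm. 8.19). [cite: RobinsonRodrigoSadowski2016, proof of Lemma 8.18] -/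
theorem IsLerayHopfOn.tendsto_lintegral_conj_mul_tail_sq (hE3 : finrank ℝ E = 3) {f : ℝ → E → E}
    (hu : IsLerayHopfOn T ν f u₀ u) {q r : ℝ≥0∞} (hr : 3 < r) (hqr : 2 / q + 3 / r ≤ 1)
    (hS : MemLqLp q r u (Ioo 0 T)) {Gu : ℝ → E → E →L[ℝ] E}
    (hGum : StronglyMeasurable (uncurry Gu))
    (hGu : ∀ᵐ t ∂(volume.restrict (Ioo 0 T)), HasWeakGradient (u t) (Gu t))
    (hGu₂ : ∫⁻ t in Ioo 0 T, ∫⁻ x, ENNReal.ofReal (frobeniusNormSq (Gu t x)) < ⊤)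
    {ut : ℝ × E → E} (hutm : StronglyMeasurable ut)
    (hut : uncurry u =ᵐ[(volume.restrict (Ioo 0 T)).prod (volume : Measure E)] ut) :
    Tendsto (fun M : ℕ => ∫⁻ s in Ioo 0 T, (eLpNorm (fun x => ut (s, x)) ((2⁻¹ - r⁻¹)⁻¹) volume *
      eLpNorm ({x | (M : ℝ) ≤ ‖ut (s, x)‖}.indicator fun x => ut (s, x)) r volume) ^ (2 : ℝ))
      atTop (𝓝 0) := by
  obtain ⟨hθ0, hθ1, -⟩ := serrin_exponent_props hr hqr
  set θ : ℝ := ((3 : ℝ≥0∞) / r).toReal with hθ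
  set q₀ : ℝ := 2 / (1 - θ) with hq₀
  have h1θ : 0 < 1 - θ := by linarith
  obtain ⟨K, hK⟩ := hu.energy_bound
  set Cs : ℝ≥0∞ := (SNormLESNormFDerivOfEqConst E (volume : Measure E) 2 : ℝ≥0∞) with hCs
  set C₁ : ℝ≥0∞ := ((K : ℝ≥0∞) ^ (1 / 2 : ℝ)) ^ (1 - θ) * Cs ^ θ with hC₁
  have hC₁top : C₁ ≠ ⊤ := ENNReal.mul_ne_top
    (ENNReal.rpow_ne_top_of_nonneg h1θ.le (ENNReal.rpow_ne_top_of_nonneg (by norm_num) ENNReal.coe_ne_top))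
    (ENNReal.rpow_ne_top_of_nonneg hθ0 ENNReal.coe_ne_top)
  set D : ℝ → ℝ≥0∞ := fun s => ∫⁻ x, ENNReal.ofReal (frobeniusNormSq (Gu s x)) with hD
  have hDm : Measurable D := measurable_lintegral_frobeniusNormSq hGum
  set m : ℕ → ℝ → ℝ≥0∞ := fun M s =>
    eLpNorm ({x | (M : ℝ) ≤ ‖ut (s, x)‖}.indicator fun x => ut (s, x)) r volume with hm
  have hmm : ∀ M : ℕ, Measurable (m M) := by
    intro M
    have hmeas : StronglyMeasurable
        (uncurry fun s x => {p : ℝ × E | (M : ℝ) ≤ ‖ut p‖}.indicator ut (s, x)) := by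
      have : (uncurry fun s x => {p : ℝ × E | (M : ℝ) ≤ ‖ut p‖}.indicator ut (s, x)) =
          {p : ℝ × E | (M : ℝ) ≤ ‖ut p‖}.indicator ut := by ext p; rfl
      rw [this]; exact hutm.indicator_le_norm (M : ℝ)
    have h := FunctionSpaces.measurable_eLpNorm_slice (μ := (volume : Measure E))
      (g := fun s x => {p : ℝ × E | (M : ℝ) ≤ ‖ut p‖}.indicator ut (s, x)) hmeas r
    simpa only [indicator_le_norm_slice] using h
  -- the pointwise bound for a.e. `s`
  have hpt : ∀ M : ℕ, ∀ᵐ s ∂(volume.restrict (Ioo 0 T)),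
      (eLpNorm (fun x => ut (s, x)) ((2⁻¹ - r⁻¹)⁻¹) volume * m M s) ^ (2 : ℝ) ≤
        C₁ ^ (2 : ℝ) * (D s ^ θ * (m M s ^ q₀) ^ (1 - θ)) := by
    intro M
    filter_upwards [hu.ae_eLpNorm_conj_version_le hE3 hr hGu hut hK] with s hs
    have hm2 : m M s ^ (2 : ℝ) = (m M s ^ q₀) ^ (1 - θ) := by
      rw [← ENNReal.rpow_mul, hq₀, div_mul_cancel₀ _ h1θ.ne']
    calc (eLpNorm (fun x => ut (s, x)) ((2⁻¹ - r⁻¹)⁻¹) volume * m M s) ^ (2 : ℝ)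
        ≤ (C₁ * D s ^ (θ / 2) * m M s) ^ (2 : ℝ) := by
          gcongr ?_ ^ _
          exact mul_le_mul' hs le_rfl
      _ = C₁ ^ (2 : ℝ) * (D s ^ θ * (m M s ^ q₀) ^ (1 - θ)) := by
          rw [ENNReal.mul_rpow_of_nonneg _ _ zero_le_two, ENNReal.mul_rpow_of_nonneg _ _ zero_le_two,
            ← ENNReal.rpow_mul, show θ / 2 * 2 = θ by ring, hm2]
          ring
  -- the integrated bound
  have hint : ∀ M : ℕ, ∫⁻ s in Ioo 0 T, (eLpNorm (fun x => ut (s, x)) ((2⁻¹ - r⁻¹)⁻¹) volume *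
      m M s) ^ (2 : ℝ) ≤ C₁ ^ (2 : ℝ) * ((∫⁻ s in Ioo 0 T, D s) ^ θ *
        (∫⁻ s in Ioo 0 T, m M s ^ q₀) ^ (1 - θ)) := by
    intro M
    calc ∫⁻ s in Ioo 0 T, (eLpNorm (fun x => ut (s, x)) ((2⁻¹ - r⁻¹)⁻¹) volume * m M s) ^ (2 : ℝ)
        ≤ ∫⁻ s in Ioo 0 T, C₁ ^ (2 : ℝ) * (D s ^ θ * (m M s ^ q₀) ^ (1 - θ)) :=
          lintegral_mono_ae (hpt M)
      _ = C₁ ^ (2 : ℝ) * ∫⁻ s in Ioo 0 T, D s ^ θ * (m M s ^ q₀) ^ (1 - θ) := by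
          rw [lintegral_const_mul' _ _ (ENNReal.rpow_ne_top_of_nonneg zero_le_two hC₁top)]
      _ ≤ C₁ ^ (2 : ℝ) * ((∫⁻ s in Ioo 0 T, D s) ^ θ * (∫⁻ s in Ioo 0 T, m M s ^ q₀) ^ (1 - θ)) := by
          gcongr
          exact ENNReal.lintegral_mul_norm_pow_le hDm.aemeasurable
            ((hmm M).pow_const _).aemeasurable hθ0 h1θ.le (by ring)
  -- the limit of the right-hand side
  have htail := tendsto_lintegral_tail_rpow hr hqr hS hutm hut
  have hR : Tendsto (fun M : ℕ => C₁ ^ (2 : ℝ) * ((∫⁻ s in Ioo 0 T, D s) ^ θ *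
      (∫⁻ s in Ioo 0 T, m M s ^ q₀) ^ (1 - θ))) atTop (𝓝 0) := by
    have h1 : Tendsto (fun M : ℕ => (∫⁻ s in Ioo 0 T, m M s ^ q₀) ^ (1 - θ)) atTop (𝓝 0) := by
      have := ((ENNReal.continuous_rpow_const (y := 1 - θ)).tendsto (0 : ℝ≥0∞)).comp htail
      rwa [ENNReal.zero_rpow_of_pos h1θ] at this
    have h2 := ENNReal.Tendsto.const_mul h1 (a := (∫⁻ s in Ioo 0 T, D s) ^ θ)
      (Or.inr (ENNReal.rpow_ne_top_of_nonneg hθ0 hGu₂.ne))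
    rw [mul_zero] at h2
    have h3 := ENNReal.Tendsto.const_mul h2 (a := C₁ ^ (2 : ℝ))
      (Or.inr (ENNReal.rpow_ne_top_of_nonneg zero_le_two hC₁top))
    rwa [mul_zero] at h3
  exact tendsto_of_tendsto_of_tendsto_of_le_of_le tendsto_const_nhds hR
    (fun _ => bot_le) hint

/-- **The B-side weight is integrable**: `∫₀ᵀ (‖G(σ)‖₂ ‖ṽ(σ)‖_p)^{2/(1+θ)} dσ < ∞` for a
Leray–Hopf solution `v` with weak-gradient witness `G` (`‖ṽ‖_p ≤ C‖∇v‖₂^θ`, so the integrand is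
`≤ C' ‖∇v(σ)‖₂²`; RRS 2016, proof of Lemma 8.18). [cite: RobinsonRodrigoSadowski2016, proof of Lemma 8.18] -/
theorem IsLerayHopfOn.lintegral_weightB_lt_top (hE3 : finrank ℝ E = 3) {f : ℝ → E → E}
    (hu : IsLerayHopfOn T ν f u₀ u) {r : ℝ≥0∞} (hr : 3 < r)
    {Gu : ℝ → E → E →L[ℝ] E}
    (hGu : ∀ᵐ t ∂(volume.restrict (Ioo 0 T)), HasWeakGradient (u t) (Gu t))
    (hGu₂ : ∫⁻ t in Ioo 0 T, ∫⁻ x, ENNReal.ofReal (frobeniusNormSq (Gu t x)) < ⊤)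
    {ut : ℝ × E → E}
    (hut : uncurry u =ᵐ[(volume.restrict (Ioo 0 T)).prod (volume : Measure E)] ut) :
    ∫⁻ σ in Ioo 0 T, ((∫⁻ x, ENNReal.ofReal (frobeniusNormSq (Gu σ x))) ^ (1 / 2 : ℝ) *
      eLpNorm (fun x => ut (σ, x)) ((2⁻¹ - r⁻¹)⁻¹) volume) ^ (2 / (1 + ((3 : ℝ≥0∞) / r).toReal))
      < ⊤ := by
  set θ : ℝ := ((3 : ℝ≥0∞) / r).toReal with hθ
  have hθ0 : 0 ≤ θ := ENNReal.toReal_nonneg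
  have hθ1 : θ ≤ 1 := by
    have hr0 : r ≠ 0 := by rintro rfl; simp at hr
    have h3r : (3 : ℝ≥0∞) / r ≤ 1 :=
      ((ENNReal.div_lt_iff (Or.inl hr0) (Or.inr (ENNReal.ofNat_ne_top (n := 3)))).2
        (by simpa using hr)).le
    have := ENNReal.toReal_mono ENNReal.one_ne_top h3r
    rwa [ENNReal.toReal_one] at this
  have h1θ : 0 < 1 + θ := by linarith
  set e : ℝ := 2 / (1 + θ) with he
  have he0 : 0 < e := div_pos two_pos h1θ
  obtain ⟨K, hK⟩ := hu.energy_bound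
  set Cs : ℝ≥0∞ := (SNormLESNormFDerivOfEqConst E (volume : Measure E) 2 : ℝ≥0∞) with hCs
  set C₁ : ℝ≥0∞ := ((K : ℝ≥0∞) ^ (1 / 2 : ℝ)) ^ (1 - θ) * Cs ^ θ with hC₁
  have hC₁top : C₁ ≠ ⊤ := ENNReal.mul_ne_top
    (ENNReal.rpow_ne_top_of_nonneg (by linarith) (ENNReal.rpow_ne_top_of_nonneg (by norm_num) ENNReal.coe_ne_top))
    (ENNReal.rpow_ne_top_of_nonneg hθ0 ENNReal.coe_ne_top)
  set D : ℝ → ℝ≥0∞ := fun s => ∫⁻ x, ENNReal.ofReal (frobeniusNormSq (Gu s x)) with hD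
  have hpt : ∀ᵐ σ ∂(volume.restrict (Ioo 0 T)),
      (D σ ^ (1 / 2 : ℝ) * eLpNorm (fun x => ut (σ, x)) ((2⁻¹ - r⁻¹)⁻¹) volume) ^ e ≤
        C₁ ^ e * D σ := by
    filter_upwards [hu.ae_eLpNorm_conj_version_le hE3 hr hGu hut hK] with σ hσ
    calc (D σ ^ (1 / 2 : ℝ) * eLpNorm (fun x => ut (σ, x)) ((2⁻¹ - r⁻¹)⁻¹) volume) ^ e
        ≤ (D σ ^ (1 / 2 : ℝ) * (C₁ * D σ ^ (θ / 2))) ^ e := by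
          gcongr ?_ ^ _
          exact mul_le_mul' le_rfl hσ
      _ = (C₁ * D σ ^ ((1 + θ) / 2)) ^ e := by
          congr 1
          rw [show (1 + θ) / 2 = 1 / 2 + θ / 2 by ring,
            ENNReal.rpow_add_of_nonneg _ _ (by norm_num) (by linarith)]
          ring
      _ = C₁ ^ e * D σ := by
          rw [ENNReal.mul_rpow_of_nonneg _ _ he0.le, ← ENNReal.rpow_mul,
            show (1 + θ) / 2 * e = 1 by rw [he]; field_simp, ENNReal.rpow_one]
  calc ∫⁻ σ in Ioo 0 T, (D σ ^ (1 / 2 : ℝ) * eLpNorm (fun x => ut (σ, x)) ((2⁻¹ - r⁻¹)⁻¹) volume) ^ e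
      ≤ ∫⁻ σ in Ioo 0 T, C₁ ^ e * D σ := lintegral_mono_ae hpt
    _ = C₁ ^ e * ∫⁻ σ in Ioo 0 T, D σ := by
        rw [lintegral_const_mul' _ _ (ENNReal.rpow_ne_top_of_nonneg he0.le hC₁top)]
    _ < ⊤ := ENNReal.mul_lt_top (ENNReal.rpow_lt_top_of_nonneg he0.le hC₁top) hGu₂

end Serrin

end Literature.Analysis.FluidPDE
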